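import Literature.Analysis.FluidPDE.KolmogorovFlowInstabilityProofs
import Literature.Analysis.FluidPDE.KolmogorovShearLinearised
import HarnessLib

/-!
# Long-wave modes of the viscous Kolmogorov flow: the Meshalkin–Sinai chain of Chen–Price 1997

Analysis/FluidPDE proof file (theorems and auxiliary definitions — the chain data `cpW`, `cpA`, the predicate `IsMode`, the window `lamSqLower`, `defect`, private lattice plumbing in §E; **no named facts**). It adds
the VISCOUS companion that the module docstring of `KolmogorovFlowInstability.lean` asks for next to
the inviscid instability `friedlanderStraussVishik1997_prop51_holds`: the existence of neutral and of
growing long-wave normal modes of the two-dimensional Navier–Stokes equations linearised at the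
Kolmogorov flow, at Reynolds numbers pinned between explicit bounds whose long-wave limit is the
Meshalkin–Sinai threshold `√2` (negative long-wave eddy viscosity `ν_E = ν − U₀²/(2νk²)`,
Frisch 1995 (9.60); Shklyaev–Nepomnyashchy 2017 (5.102)–(5.103)).

## The printed setting (Chen–Price 1997, §1–§2, verbatim where quoted)

On the torus `[0,2π]²` consider "`∂ₜu − Δu + λ u·∇u + ∇p = (k² sin ky, 0)`, `∇·u = 0`", `∫u = 0`,
`k ≥ 2` an integer, "`λ > 0` is the Reynolds number" (op. cit. (1)–(2)); the laminar state is
`u₀ = (sin ky, 0)`, stream function `ψ₀ = −(1/k) cos ky` (`u = (∂_yψ, −∂ₓψ)`). Writing the equation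
for the stream function ((5): `∂ₜψ − Δψ + λΔ⁻¹(∂_yψ ∂ₓΔψ − ∂ₓψ ∂_yΔψ) = forcing`) and linearising
at `ψ₀`, the perturbation `φ` obeys `∂ₜφ = Δφ − λA_kφ`, `A_kφ = Δ⁻¹[sin(ky) ∂ₓ(Δ + k²)φ]`, and
"the pitchfork bifurcation problem … is largely based on the spectral behavior of the operator
`−Δ + λA_k`" (op. cit. p. 305): a solution of `(−Δ + λA_k)φ = ρφ` is a normal mode `e^{−ρt}φ`,
neutral for `ρ = 0` and GROWING at rate `s = −ρ > 0` for `ρ < 0`. In the invariant class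
`φ = Σ_{m∈ℤ} ξ_m cos(lx + mky)` (`l ≥ 1` the perturbation wavenumber ACROSS the basic period,
op. cit. (8)) the eigenvalue problem "becomes
`λα_{l,m−1}ξ_{l,m−1}/(2β_{l,m}) − λα_{l,m+1}ξ_{l,m+1}/(2β_{l,m}) + (β_{l,m} − ρ)ξ_{l,m} = 0` (9) for any
integer `m`, where `β_{l,m} = l² + m²k²` and `α_{l,m} = l(l² + m²k² − k²)` (10)" — the
**Meshalkin–Sinai chain**, solved in op. cit. (11)–(14) and in Meshalkin–Sinai 1961 by continued
fractions. (Derivation, for the record: `(Δ + k²)cos θ_m = −(β_m − k²)cos θ_m`, `θ_m = lx + mky`;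
`sin(ky) sin θ_m = ½(cos θ_{m−1} − cos θ_{m+1})`; `Δ⁻¹cos θ_m = −cos θ_m/β_m`.) Chen–Price,
**Lemma 2.2**: "For `k ≥ 2`, there exist exactly `k−1` real functions and `k−1` real numbers
`ρ₁(λ) < ⋯ < ρ_{k−1}(λ)` with `λ > 0` and `0 < λ₁ < ⋯ < λ_{k−1}` satisfying `ρ_l(λ_l) = 0`,
`2(k²+l²)²/(k²−l²) < λ_l²`, `(d/dλ)ρ_l(λ) < 0`, `dim ker(−Δ + λA_k − ρ) ≤ 1` in `H²_{1,k}` for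
`l = 1,…,k−1` …", Cor. 2.2: for `l = 0` or `l ≥ k` the laminar state "is always stable for all
`λ > 0`". (The display on p. 305 prints the operator as `Δ⁻¹ sin ky (Δ + k²)∂_y`; the recurrence
(9)–(10), whose `α_{l,m}` carries the factor `l`, fixes the derivative as `∂ₓ` — with `∂_y` the class
`l = 0` would not decouple, contradicting Cor. 2.2.) Units: viscosity `1`, shear amplitude `1`, shear
wavenumber `k`; the Reynolds number `Re = U₀/(νk_shear)` of Meshalkin–Sinai / Frisch (9.60) is `λ/k`
and the long-wave ratio is `a = l/k`, so the printed bound reads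
`Re_c(a)² > 2(1+a²)²/(1−a²)`, `Re_c → √2` as `a → 0` (Meshalkin–Sinai; Shklyaev–Nepomnyashchy
(5.103): `R = √2[1 + 3k_m²/2 + O(k_m⁴)]`).

## What is proved here

With `d_m = α_m ξ_m` the chain (9) with `ρ = −s` is `d_{m+1} − d_{m−1} = A_m d_m`,
`A_m = 2β_m(β_m + s)/(λ α_m)`, `A₀ < 0 < A_m` (`m ≠ 0`, `1 ≤ l < k`, `s ≥ 0`) — the shape of the
inviscid chain of Friedlander–Strauss–Vishik 1997 (5.9) with `σ = 1/λ` in the role of the unknown.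
Re-using the continued-fraction lemmas of `KolmogorovFlowInstabilityProofs`
(`FriedlanderStraussVishik1997.cf_*`, `exists_d`) we prove:

* `KolmogorovViscous.exists_root` — the characteristic equation `u₀(σ) = cσ` of a positive chain
  (`u₀` the infinite continued fraction `1/(σb₀ + 1/(σb₁ + ⋯))`, `bₙ ≥ 2`) has a root whenever
  `c < b₁`, and EVERY root satisfies `(1 − c/b₁)/(cb₀) ≤ σ² ≤ 1/(cb₀)` (the two lowest truncations
  of the continued fraction; Chen–Price prove `λ_l² > 2(k²+l²)²/(k²−l²)` from the first one).
* `KolmogorovViscous.exists_mode` — **for integers `1 ≤ l < k` and every growth rate `s ≥ 0` in the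
  range `l²(l²+s)(l²+3k²) < 2(k²−l²)(l²+4k²)(l²+4k²+s)` there is a Reynolds number `λ > 0` with
  `Λ ≤ λ² ≤ Λ/(1 − θ)`, `Λ = 2(l²+s)(l²+k²)(l²+k²+s)/(l²(k²−l²))`,
  `θ = l²(l²+s)(l²+3k²)/(2(k²−l²)(l²+4k²)(l²+4k²+s))`, and a real, not identically zero,
  exponentially decaying sequence `ξ` on `ℤ` solving the chain (9) with `ρ = −s`** — a normal mode
  `e^{st} Σ ξ_m cos(lx + mky)` of the linearised problem growing at rate `s` (neutral for `s = 0`).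
* `KolmogorovViscous.exists_mode_of_two_mul_le` — for `2l ≤ k` (long waves, `a ≤ 1/2`) the range
  condition holds for EVERY `s ≥ 0`; `KolmogorovViscous.exists_neutralMode` — the neutral curve:
  `2(l²+k²)²/(k²−l²) ≤ λ² ≤ 2(l²+k²)²/(k²−l²) · (1 − (l/k)⁴/4)⁻¹`, i.e. with `Re = λ/k`, `a = l/k`,
  `2(1+a²)²/(1−a²) ≤ Re_c(a)² ≤ 2(1+a²)²/((1−a²)(1 − a⁴/4))`, both ends `→ 2` as `a → 0`
  (the sharper window `θ(k,l,0) = l⁴(l²+3k²)/(2(k²−l²)(l²+4k²)²) ≤ (l/k)⁴/4` is `exists_mode`'s).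
* `KolmogorovViscous.exists_growingMode` — **instability at EVERY Reynolds number above the
  window: for integers `1 ≤ l < k` and every `λ > 0` with `λ²(1 − θ(k,l,0)) > Λ(k,l,0)` the chain
  (9) has an exponentially decaying real solution `ξ`, `ξ₀ ≠ 0`, with `ρ = −s` for some `s > 0`**
  (a growing normal mode `e^{st}Σ ξ_m cos(lx + mky)`). This is the content of Chen–Price's
  "`(d/dλ)ρ_l(λ) < 0`, `ρ_l(λ_l) = 0`" that a barrier needs (laminar Kolmogorov flow is linearly
  unstable to long waves at all Reynolds numbers beyond the Meshalkin–Sinai threshold), proved here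
  WITHOUT the monotonicity of the branches: at fixed `σ = 1/λ` the characteristic function is
  continuous in the growth rate `s` (uniform convergence of the truncated continued fractions),
  positive at `s = 0` and negative at `s = lλ`; intermediate value theorem.
  `KolmogorovViscous.exists_growingMode_of_two_mul_le` — for `2l ≤ k`: every `λ` with
  `λ²(1 − (l/k)⁴/4) > 2(l²+k²)²/(k²−l²)` carries a growing mode; with `Re = λ/k`, `a = l/k ≤ 1/2`:
  every `Re² > 2(1+a²)²/((1−a²)(1−a⁴/4))`.

* Section E, `KolmogorovViscous.isLinNSEigenvalue_of_isMode`,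
  `KolmogorovViscous.exists_pos_isLinNSEigenvalue(_of_two_mul_le)` — **the same statement in the
  tree's own vocabulary** (`Torus.IsLinNSEigenvalue` of `LinearizedNSTorus`, flat unit torus `T³`):
  for a smooth real `U : T³ → ℝ³` with Fourier support `{±k e₁}` and values parallel to `e₀`
  (`U = A sin(2πk x₁ + φ) e₀`, `A = 2|Û(ke₁)₀|`), viscosity `ν > 0`, and `λ = A/(2πν)` above the
  window for some `1 ≤ l < k`, the classical linearisation `νΔw − (U·∇)w − (w·∇)U − ∇q`
  (`div w = 0`, `∫ w = 0`) has a positive real eigenvalue `μ = 4π²νs`; the eigenfunction is the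
  Fourier synthesis of the chain mode (`Torus.fourierSynth`, coefficient dictionary of
  `SteadyNSLatticePersistence` §H / `KolmogorovShearLinearised` §2). For `2l ≤ k` the hypothesis is
  `Re² (1 − a⁴/4) > 2(1+a²)²/(1−a²)`, `Re = A/(2πkν) = λ/k`, `a = l/k`.

NOT proved here (and not claimed): uniqueness of the branches `ρ_l(λ)` and of the growth rate `s`
at given `λ`, the absence of non-real eigenvalues, the count `k − 1`, stability BELOW the window
(`λ² < Λ(k,l,0)` for all `l`), and the pitchfork bifurcation (Chen–Price Lemma 2.2 in full,
Thm. 2.1). The short-wave corner (gravest shear, `k = 1`, where no `l < k` exists) is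
`KolmogorovShear.not_isLinNSEigenvalue_shear`: `0` is never an eigenvalue there.

## References

* Z.-M. Chen, W. G. Price, *Long-time behavior of Navier–Stokes flow on a two-dimensional torus
  excited by an external sinusoidal force*, J. Stat. Phys. 86 (1997) 301–335,
  doi:10.1007/bf02180208 (held: `paper:galaxy-pdf-3328648307755401340`), §1 (1)–(5), §2 (7)–(14),
  Lemma 2.2, Cor. 2.2. [`ChenPrice1997`]
* L. D. Meshalkin, Ya. G. Sinai, *Investigation of the stability of a stationary solution of a
  system of equations for the plane movement of an incompressible viscous liquid*, J. Appl. Math.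
  Mech. 25 (1961) 1700–1705. [`MeshalkinSinai1961`]
* S. Shklyaev, A. Nepomnyashchy, *Longwave Instabilities and Patterns in Fluids*, Birkhäuser (2017),
  §5.2, (5.102)–(5.103) (growth rate `σ(k,R) = (R²/2 − 1)k² − R²(1 + R²/4)k⁴ + O(k⁶)`, neutral curve
  `R = √2[1 + 3k²/2 + O(k⁴)]`).
* S. Friedlander, W. Strauss, M. Vishik, Ann. Inst. H. Poincaré Anal. Non Linéaire 14 (1997)
  187–209, §5 (the continued-fraction lemmas re-used here). [`FriedlanderStraussVishik1997`]
* U. Frisch, *Turbulence*, CUP (1995), §9.6.3 (9.59)–(9.60) (`ν_E = ν − 1/(2ν)`, `ν_c = 1/√2`).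
* L. Grafakos, *Classical Fourier Analysis*, 3rd ed., Springer GTM 249 (2014), Prop. 3.2.4 (uniqueness of
  Fourier coefficients), used in §E through `Torus.eq_zero_of_forall_mFourierCoeff_eq_zero`. [`Grafakos2014`]
-/

noncomputable section

open Filter
open scoped Topology

namespace Literature.Analysis.FluidPDE

namespace KolmogorovViscous

open FriedlanderStraussVishik1997

/-! ### The chain of Chen–Price (9)–(10) -/

/-- `β_{l,m} = l² + m²k²` of Chen–Price (10) (the eigenvalue of `−Δ` on `cos(lx + mky)`), as a
function of a real mode index `x` (used at `x = m ∈ ℤ`). [cite: ChenPrice1997, §2 (10)] -/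
def cpW (k l x : ℝ) : ℝ := l ^ 2 + x ^ 2 * k ^ 2

/-- `α_{l,m} = l(l² + m²k² − k²)` of Chen–Price (10). [cite: ChenPrice1997, §2 (10)] -/
def cpA (k l x : ℝ) : ℝ := l * (cpW k l x - k ^ 2)

/-- **The Meshalkin–Sinai chain (Chen–Price 1997, (9)).** A real sequence `ξ` on `ℤ` is a mode of
the linearised Kolmogorov problem (forcing wavenumber `k`, Reynolds number `lam`, perturbation
wavenumber `l`, spectral parameter `ρ`: the normal mode is `e^{−ρt} Σ_m ξ_m cos(lx + mky)`) when
`λα_{m−1}ξ_{m−1}/(2β_m) − λα_{m+1}ξ_{m+1}/(2β_m) + (β_m − ρ)ξ_m = 0` for every integer `m`.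
[cite: ChenPrice1997, §2 (9)] -/
def IsMode (k l lam ρ : ℝ) (ξ : ℤ → ℝ) : Prop :=
  ∀ m : ℤ, lam * cpA k l ((m : ℝ) - 1) * ξ (m - 1) / (2 * cpW k l m)
      - lam * cpA k l ((m : ℝ) + 1) * ξ (m + 1) / (2 * cpW k l m) + (cpW k l m - ρ) * ξ m = 0

/-- The lower end `Λ(k,l,s) = 2(l²+s)(l²+k²)(l²+k²+s)/(l²(k²−l²))` of the Reynolds-number window of
`exists_mode`; `Λ(k,l,0) = 2(k²+l²)²/(k²−l²)` is Chen–Price's bound of Lemma 2.2.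
[cite: ChenPrice1997, Lemma 2.2] -/
def lamSqLower (k l s : ℝ) : ℝ :=
  2 * (l ^ 2 + s) * (l ^ 2 + k ^ 2) * (l ^ 2 + k ^ 2 + s) / (l ^ 2 * (k ^ 2 - l ^ 2))

/-- The relative width `θ(k,l,s) = l²(l²+s)(l²+3k²)/(2(k²−l²)(l²+4k²)(l²+4k²+s))` of the window of
`exists_mode` (second truncation of the continued fraction). [folklore] -/
def defect (k l s : ℝ) : ℝ :=
  l ^ 2 * (l ^ 2 + s) * (l ^ 2 + 3 * k ^ 2) / (2 * (k ^ 2 - l ^ 2) * (l ^ 2 + 4 * k ^ 2) * (l ^ 2 + 4 * k ^ 2 + s))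

/-! ### The characteristic equation of a positive chain: a root with two-sided bounds -/

variable {β : ℕ → ℝ} {T : ℝ → ℕ → ℕ → ℝ}

/-- **Root of the characteristic equation with two-sided bounds.** For a chain with elements
`bₙ ≥ 2` let `u₀(σ) = 1/(σb₀ + 1/(σb₁ + ⋯))` be the infinite continued fraction of
`FriedlanderStraussVishik1997.cf_exists_limit`. If `0 < c < b₁` then `u₀(σ) = cσ` has a root
`σ > 0`, and at every such root `1 − c/b₁ ≤ c b₀ σ² ≤ 1` (compare `u₀` with its first two
truncations `1/(σb₀)` and `1/(σb₀ + 1/(σb₁))`; intermediate value theorem in between).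
[cite: ChenPrice1997, §2, proof of Lemma 2.2 ((15)–(17) and the bound λ_l² > 2(k²+l²)²/(k²−l²))] -/
theorem exists_root (H : (∀ n, 2 ≤ β n) ∧ (∀ σ n, T σ 0 n = 0) ∧
      ∀ σ N n, T σ (N + 1) n = 1 / (σ * β n + T σ N (n + 1)))
    {u : ℝ → ℕ → ℝ} (hu : ∀ σ, 0 < σ → ∀ n, Tendsto (fun N => T σ N n) atTop (𝓝 (u σ n)))
    {c : ℝ} (hc : 0 < c) (hcb : c < β 1) :
    ∃ σ : ℝ, 0 < σ ∧ u σ 0 = c * σ ∧ σ ^ 2 * (c * β 0) ≤ 1 ∧ 1 - c / β 1 ≤ σ ^ 2 * (c * β 0) := by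
  have hb0 : 0 < β 0 := by linarith [H.1 0]
  have hb1 : 0 < β 1 := by linarith [H.1 1]
  have hcb0 : 0 < c * β 0 := mul_pos hc hb0
  have hθ : 0 < 1 - c / β 1 := by
    rw [sub_pos, div_lt_one hb1]; exact hcb
  -- the window [σlo, σhi]
  set x : ℝ := (1 - c / β 1) / (c * β 0) with hx
  have hx0 : 0 < x := div_pos hθ hcb0
  set σlo : ℝ := min x 1 / 2 with hσlo
  set σhi : ℝ := 1 + 1 / (c * β 0) with hσhi
  have hlo0 : 0 < σlo := by
    rw [hσlo]; exact div_pos (lt_min hx0 one_pos) two_pos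
  have hlo_le_x : σlo ≤ x / 2 := by
    rw [hσlo]; exact div_le_div_of_nonneg_right (min_le_left _ _) zero_le_two
  have hlo_le_half : σlo ≤ 1 / 2 := by
    rw [hσlo]; exact div_le_div_of_nonneg_right (min_le_right _ _) zero_le_two
  have hlo_sq : σlo ^ 2 < x := by
    have h1 : σlo ^ 2 ≤ x / 2 * (1 / 2) := by
      rw [sq]; exact mul_le_mul hlo_le_x hlo_le_half hlo0.le (by linarith)
    linarith
  have hhi1 : 1 ≤ σhi := by rw [hσhi]; simp only [le_add_iff_nonneg_right]; positivity
  have hhi0 : 0 < σhi := lt_of_lt_of_le one_pos hhi1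
  have hhi_sq : 1 < σhi ^ 2 * (c * β 0) := by
    have h1 : 1 / (c * β 0) < σhi := by rw [hσhi]; linarith
    have h2 : σhi ≤ σhi ^ 2 := by nlinarith
    have h3 : 1 < σhi * (c * β 0) := by rwa [div_lt_iff₀ hcb0] at h1
    nlinarith
  have hlohi : σlo ≤ σhi := by linarith
  -- the characteristic function and its signs at the ends
  have hcont : ContinuousOn (fun σ => u σ 0 - c * σ) (Set.Icc σlo σhi) :=
    ((cf_continuousOn_limit H hu hlo0 0).mono Set.Icc_subset_Ici_self).sub
      (continuousOn_const.mul continuousOn_id)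
  have hFhi : u σhi 0 - c * σhi < 0 := by
    obtain ⟨-, hle, -⟩ := cf_limit_props H hhi0 (hu σhi hhi0) 0
    have h1 : 1 / (σhi * β 0) < c * σhi := by
      rw [div_lt_iff₀ (mul_pos hhi0 hb0)]; nlinarith
    linarith
  have hFlo : 0 < u σlo 0 - c * σlo := by
    obtain ⟨-, -, hrel⟩ := cf_limit_props H hlo0 (hu σlo hlo0) 0
    obtain ⟨hpos1, hle1, -⟩ := cf_limit_props H hlo0 (hu σlo hlo0) 1
    have hD : 0 < σlo * β 0 + 1 / (σlo * β 1) := by positivity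
    have hlow : 1 / (σlo * β 0 + 1 / (σlo * β 1)) ≤ u σlo 0 := by
      rw [hrel]
      exact one_div_le_one_div_of_le (by positivity) (by linarith)
    have hkey : c * σlo < 1 / (σlo * β 0 + 1 / (σlo * β 1)) := by
      rw [lt_div_iff₀ hD]
      have e1 : c * σlo * (σlo * β 0 + 1 / (σlo * β 1)) = σlo ^ 2 * (c * β 0) + c / β 1 := by
        field_simp
      rw [e1]
      have h2 : σlo ^ 2 * (c * β 0) < 1 - c / β 1 := by
        have := mul_lt_mul_of_pos_right hlo_sq hcb0
        rwa [hx, div_mul_cancel₀ _ hcb0.ne'] at this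
      linarith
    linarith
  -- intermediate value theorem
  have hmem : (0 : ℝ) ∈ Set.Icc ((fun σ => u σ 0 - c * σ) σhi) ((fun σ => u σ 0 - c * σ) σlo) :=
    ⟨hFhi.le, hFlo.le⟩
  obtain ⟨σ, ⟨hσ1, hσ2⟩, hσ⟩ := intermediate_value_Icc' hlohi hcont hmem
  have hσ0 : 0 < σ := lt_of_lt_of_le hlo0 hσ1
  have hroot : u σ 0 = c * σ := (sub_eq_zero.1 hσ)
  refine ⟨σ, hσ0, hroot, ?_, ?_⟩
  · -- upper bound from `u₀ ≤ 1/(σ b₀)`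
    obtain ⟨-, hle, -⟩ := cf_limit_props H hσ0 (hu σ hσ0) 0
    rw [hroot, le_div_iff₀ (mul_pos hσ0 hb0)] at hle
    nlinarith
  · -- lower bound from `u₀ = 1/(σ b₀ + u₁) ≥ 1/(σ b₀ + 1/(σ b₁))`
    obtain ⟨-, -, hrel⟩ := cf_limit_props H hσ0 (hu σ hσ0) 0
    obtain ⟨hpos1, hle1, -⟩ := cf_limit_props H hσ0 (hu σ hσ0) 1
    have hD : 0 < σ * β 0 + 1 / (σ * β 1) := by positivity
    have hlow : 1 / (σ * β 0 + 1 / (σ * β 1)) ≤ c * σ := by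
      rw [← hroot, hrel]
      exact one_div_le_one_div_of_le (by positivity) (by linarith)
    rw [div_le_iff₀ hD] at hlow
    have e1 : c * σ * (σ * β 0 + 1 / (σ * β 1)) = σ ^ 2 * (c * β 0) + c / β 1 := by
      field_simp
    rw [e1] at hlow
    linarith

/-! ### The modes -/

/-- Positivity bookkeeping: `l ≤ β_{l,x}` for `1 ≤ l`. [folklore] -/
private theorem cpW_ge (k : ℝ) {l : ℝ} (hl : 1 ≤ l) (x : ℝ) : l ≤ cpW k l x := by
  unfold cpW; nlinarith [sq_nonneg x, sq_nonneg k, mul_nonneg (sq_nonneg x) (sq_nonneg k)]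

/-- Positivity bookkeeping: `1 ≤ α_{l,x}` for `1 ≤ l` and `x² ≥ 1`. [folklore] -/
private theorem one_le_cpA (k : ℝ) {l : ℝ} (hl : 1 ≤ l) {x : ℝ} (hx : 1 ≤ x ^ 2) : 1 ≤ cpA k l x := by
  unfold cpA cpW
  have h1 : 1 ≤ l ^ 2 := by nlinarith
  have h2 : 0 ≤ (x ^ 2 - 1) * k ^ 2 := mul_nonneg (by linarith) (sq_nonneg k)
  nlinarith

/-- Sign bookkeeping: `α_{l,0} = l(l² − k²) ≤ −1` for integers `1 ≤ l < k` (the one negative coefficient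
of the chain). [folklore] -/
private theorem cpA_zero_le {k l : ℕ} (hl : 1 ≤ l) (hlk : l < k) : cpA k l 0 ≤ -1 := by
  unfold cpA cpW
  have hl' : (1 : ℝ) ≤ l := by exact_mod_cast hl
  have hk' : (l : ℝ) + 1 ≤ k := by exact_mod_cast hlk
  have h1 : (1 : ℝ) ≤ (k : ℝ) ^ 2 - (l : ℝ) ^ 2 := by nlinarith
  nlinarith

/-- The elements `bₙ = 2β_{n+1}(β_{n+1}+s)/α_{n+1}` of the chain are `≥ 2` (for `1 ≤ l`, `s ≥ 0`).
[folklore] -/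
private theorem two_le_chainElt {k l : ℝ} (hl : 1 ≤ l) {s : ℝ} (hs : 0 ≤ s) (n : ℕ) :
    2 ≤ 2 * cpW k l ((n : ℝ) + 1) * (cpW k l ((n : ℝ) + 1) + s) / cpA k l ((n : ℝ) + 1) := by
  have hsq : (1 : ℝ) ≤ ((n : ℝ) + 1) ^ 2 := by nlinarith [(Nat.cast_nonneg n : (0 : ℝ) ≤ n)]
  have hApos : 0 < cpA k l ((n : ℝ) + 1) := lt_of_lt_of_le one_pos (one_le_cpA k hl hsq)
  have hW : l ≤ cpW k l ((n : ℝ) + 1) := cpW_ge k hl _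
  rw [le_div_iff₀ hApos]
  have hA : cpA k l ((n : ℝ) + 1) ≤ l * cpW k l ((n : ℝ) + 1) := by
    unfold cpA; nlinarith [sq_nonneg k]
  have hW0 : 0 ≤ cpW k l ((n : ℝ) + 1) := by linarith
  nlinarith [mul_nonneg hW0 hs]

/-- **From a root of the characteristic equation to a mode.** For the chain of parameters
`(k, l, s)` at `σ = 1/λ`: if the tails `vₙ` of the continued fraction `1/(σb₀ + 1/(σb₁ + ⋯))`
satisfy `v₀ = σ l(l²+s)/(k²−l²)`, then `ξ_m = d_m/α_m`, with `d` the minimal solution of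
`FriedlanderStraussVishik1997.exists_d`, is an exponentially decaying mode with `ξ₀ ≠ 0`.
[cite: ChenPrice1997, §2 (11)–(14)] -/
private theorem mode_of_root {k l : ℕ} (hl : 1 ≤ l) (hlk : l < k) {s : ℝ} (hs : 0 ≤ s)
    {β : ℕ → ℝ} (hβdef : ∀ n, β n =
      2 * cpW k l ((n : ℝ) + 1) * (cpW k l ((n : ℝ) + 1) + s) / cpA k l ((n : ℝ) + 1))
    {T : ℝ → ℕ → ℕ → ℝ} (H : (∀ n, 2 ≤ β n) ∧ (∀ σ n, T σ 0 n = 0) ∧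
      ∀ σ N n, T σ (N + 1) n = 1 / (σ * β n + T σ N (n + 1)))
    {σ : ℝ} (hσ : 0 < σ) {v : ℕ → ℝ} (hv : ∀ n, Tendsto (fun N => T σ N n) atTop (𝓝 (v n)))
    (hchar : v 0 = (l : ℝ) * ((l : ℝ) ^ 2 + s) / ((k : ℝ) ^ 2 - (l : ℝ) ^ 2) * σ) :
    ∃ ξ : ℤ → ℝ, ξ 0 ≠ 0 ∧
      (∃ K r : ℝ, 0 ≤ K ∧ 0 < r ∧ r < 1 ∧ ∀ m : ℤ, |ξ m| ≤ K * r ^ m.natAbs) ∧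
      IsMode k l (1 / σ) (-s) ξ := by
  have hl' : (1 : ℝ) ≤ l := by exact_mod_cast hl
  have hl0 : (0 : ℝ) < l := by linarith
  have hkl : (l : ℝ) + 1 ≤ k := by exact_mod_cast hlk
  have hgap0 : (0 : ℝ) < (k : ℝ) ^ 2 - (l : ℝ) ^ 2 := by nlinarith
  have hgapne : (k : ℝ) ^ 2 - (l : ℝ) ^ 2 ≠ 0 := hgap0.ne'
  have hgapne' : (l : ℝ) ^ 2 - (k : ℝ) ^ 2 ≠ 0 := by
    intro h; apply hgapne; linarith
  have hprops := cf_limit_props H hσ hv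
  obtain ⟨d, hd0, hd01, hpos, hneg, -, -, K, r, hK, hr0, hr1, hdec⟩ :=
    exists_d H.1 hσ (fun n => (hprops n).1) (fun n => (hprops n).2.1) (fun n => (hprops n).2.2)
  -- α never vanishes on the chain; |α_m| ≥ 1
  have hA_abs : ∀ m : ℤ, 1 ≤ |cpA k l (m : ℝ)| := by
    intro m
    by_cases hm : m = 0
    · subst hm
      have h := cpA_zero_le hl hlk
      rw [Int.cast_zero, abs_of_neg (by linarith)]
      linarith
    · have hm1 : (1 : ℝ) ≤ (m : ℝ) ^ 2 := by
        have : 1 ≤ |m| := Int.one_le_abs hm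
        have h' : (1 : ℝ) ≤ |(m : ℝ)| := by exact_mod_cast this
        nlinarith [sq_abs (m : ℝ), abs_nonneg (m : ℝ)]
      have h := one_le_cpA (k : ℝ) hl' hm1
      rwa [abs_of_pos (by linarith)]
  have hA_ne : ∀ m : ℤ, cpA k l (m : ℝ) ≠ 0 := fun m h => by
    have := hA_abs m; rw [h, abs_zero] at this; linarith
  have hA0ne : cpA k l (0 : ℝ) ≠ 0 := by
    have := hA_ne 0; rwa [Int.cast_zero] at this
  -- the recurrence d_{m+1} − d_{m−1} = (2 β_m (β_m + s) σ / α_m) d_m at every integer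
  have hW0' : cpW k l 0 = (l : ℝ) ^ 2 := by unfold cpW; ring
  have hA0' : cpA k l 0 = (l : ℝ) * ((l : ℝ) ^ 2 - (k : ℝ) ^ 2) := by unfold cpA cpW; ring
  have hzero : d (0 + 1) - d (0 - 1) =
      2 * cpW k l 0 * (cpW k l 0 + s) * σ / cpA k l 0 * d 0 := by
    rw [zero_add, zero_sub, hd01, hd0, hchar, hW0', hA0']
    field_simp
    ring
  have hrec : ∀ m : ℤ, d (m + 1) - d (m - 1) =
      2 * cpW k l (m : ℝ) * (cpW k l (m : ℝ) + s) * σ / cpA k l (m : ℝ) * d m := by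
    intro m
    obtain ⟨n, rfl | rfl⟩ := m.eq_nat_or_neg
    · cases n with
      | zero => push_cast; exact hzero
      | succ n =>
        push_cast
        rw [show (n : ℤ) + 1 + 1 = n + 2 by ring, show (n : ℤ) + 1 - 1 = n by ring, hpos n, hβdef]
        ring
    · cases n with
      | zero => push_cast; simp only [neg_zero]; exact hzero
      | succ n =>
        push_cast
        rw [show -((n : ℤ) + 1) + 1 = -(n : ℤ) by ring,
          show -((n : ℤ) + 1) - 1 = -(n : ℤ) - 2 by ring,
          show -((n : ℤ) + 1) = -(n : ℤ) - 1 by ring, hneg n, hβdef]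
        unfold cpA cpW
        ring
  refine ⟨fun m => d m / cpA k l (m : ℝ), ?_, ⟨K, r, hK, hr0, hr1, fun m => ?_⟩, ?_⟩
  · -- ξ₀ ≠ 0
    show d 0 / cpA k l ((0 : ℤ) : ℝ) ≠ 0
    rw [Int.cast_zero, hd0]
    exact div_ne_zero one_ne_zero hA0ne
  · -- exponential decay: |ξ_m| ≤ |d_m| ≤ K r^{|m|}
    rw [abs_div]
    exact (div_le_self (abs_nonneg _) (hA_abs m)).trans (hdec m)
  · -- the chain (9) with ρ = −s
    intro m
    beta_reduce
    have hW : 0 < cpW k l (m : ℝ) := lt_of_lt_of_le hl0 (cpW_ge k hl' _)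
    have hA := hA_ne m
    have h1 : cpA k l ((m : ℝ) - 1) * (d (m - 1) / cpA k l (((m - 1 : ℤ)) : ℝ)) = d (m - 1) := by
      rw [show (((m - 1 : ℤ)) : ℝ) = (m : ℝ) - 1 by push_cast; ring]
      exact mul_div_cancel₀ _ (by have := hA_ne (m - 1); push_cast at this; exact this)
    have h2 : cpA k l ((m : ℝ) + 1) * (d (m + 1) / cpA k l (((m + 1 : ℤ)) : ℝ)) = d (m + 1) := by
      rw [show (((m + 1 : ℤ)) : ℝ) = (m : ℝ) + 1 by push_cast; ring]
      exact mul_div_cancel₀ _ (by have := hA_ne (m + 1); push_cast at this; exact this)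
    have e3 : (cpW k l (m : ℝ) + s) * (d m / cpA k l (m : ℝ)) =
        1 / σ * (d (m + 1) - d (m - 1)) / (2 * cpW k l (m : ℝ)) := by
      rw [hrec m]
      field_simp
    rw [mul_assoc (1 / σ), h1, mul_assoc (1 / σ), h2, sub_neg_eq_add, e3]
    ring

/-- **Existence of a long-wave normal mode of growth rate `s` (Chen–Price 1997 (9), Meshalkin–Sinai
1961).** For integers `1 ≤ l < k` and a growth rate `s ≥ 0` in the range
`l²(l²+s)(l²+3k²) < 2(k²−l²)(l²+4k²)(l²+4k²+s)` there is a Reynolds number `λ > 0` with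
`Λ(k,l,s) ≤ λ² ≤ Λ(k,l,s)/(1 − θ(k,l,s))` (`lamSqLower`, `defect`) at which the Navier–Stokes
equations on `[0,2π]²` linearised at the Kolmogorov flow `(sin ky, 0)` (viscosity `1`) have the
normal mode `e^{st} Σ_{m∈ℤ} ξ_m cos(lx + mky)`: a real sequence `ξ` with `ξ₀ ≠ 0`, exponentially
decaying, solving the chain (9) with `ρ = −s`. Proof: Meshalkin–Sinai continued fractions — with
`d_m = α_m ξ_m` the chain is `d_{m+1} − d_{m−1} = (2β_m(β_m + s)/(λα_m)) d_m` with a negative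
coefficient at `m = 0` only, the inviscid chain of FSV 1997 (5.9) with `σ = 1/λ`; the minimal
solution is built from the tails of `1/(σb₀ + 1/(σb₁ + ⋯))`, `bₙ = 2β_{n+1}(β_{n+1} + s)/α_{n+1} ≥ 2`
(`FriedlanderStraussVishik1997.exists_d`), and `σ` is a root of `u₀(σ) = σ l(l²+s)/(k²−l²)`
(`exists_root`). [cite: ChenPrice1997, §2 (9)–(14), Lemma 2.2] -/
theorem exists_mode {k l : ℕ} (hl : 1 ≤ l) (hlk : l < k) {s : ℝ} (hs : 0 ≤ s)
    (hcb : (l : ℝ) ^ 2 * ((l : ℝ) ^ 2 + s) * ((l : ℝ) ^ 2 + 3 * (k : ℝ) ^ 2) <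
      2 * ((k : ℝ) ^ 2 - (l : ℝ) ^ 2) * ((l : ℝ) ^ 2 + 4 * (k : ℝ) ^ 2) * ((l : ℝ) ^ 2 + 4 * (k : ℝ) ^ 2 + s)) :
    ∃ lam : ℝ, 0 < lam ∧ lamSqLower k l s ≤ lam ^ 2 ∧ lam ^ 2 * (1 - defect k l s) ≤ lamSqLower k l s ∧
      ∃ ξ : ℤ → ℝ, ξ 0 ≠ 0 ∧
        (∃ K r : ℝ, 0 ≤ K ∧ 0 < r ∧ r < 1 ∧ ∀ m : ℤ, |ξ m| ≤ K * r ^ m.natAbs) ∧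
        IsMode k l lam (-s) ξ := by
  -- real casts of the integer parameters
  have hl' : (1 : ℝ) ≤ l := by exact_mod_cast hl
  have hl0 : (0 : ℝ) < l := by linarith
  have hkl : (l : ℝ) + 1 ≤ k := by exact_mod_cast hlk
  have hgap0 : (0 : ℝ) < (k : ℝ) ^ 2 - (l : ℝ) ^ 2 := by nlinarith
  have hgapne : (k : ℝ) ^ 2 - (l : ℝ) ^ 2 ≠ 0 := hgap0.ne'
  have h3k : (l : ℝ) ^ 2 + 3 * (k : ℝ) ^ 2 ≠ 0 := by positivity
  have h4k : (l : ℝ) ^ 2 + 4 * (k : ℝ) ^ 2 ≠ 0 := by positivity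
  have h4ks : (l : ℝ) ^ 2 + 4 * (k : ℝ) ^ 2 + s ≠ 0 := by positivity
  have h1ks : (l : ℝ) ^ 2 + (k : ℝ) ^ 2 + s ≠ 0 := by positivity
  -- the elements bₙ of the chain, the truncated continued fractions and their limits
  obtain ⟨β, hβdef⟩ : ∃ β : ℕ → ℝ, ∀ n, β n =
      2 * cpW k l ((n : ℝ) + 1) * (cpW k l ((n : ℝ) + 1) + s) / cpA k l ((n : ℝ) + 1) :=
    ⟨_, fun n => rfl⟩
  have hβ : ∀ n, 2 ≤ β n := fun n => by rw [hβdef]; exact two_le_chainElt hl' hs n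
  obtain ⟨T, hT0, hTs⟩ : ∃ T : ℝ → ℕ → ℕ → ℝ, (∀ σ n, T σ 0 n = 0) ∧
      ∀ σ N n, T σ (N + 1) n = 1 / (σ * β n + T σ N (n + 1)) :=
    ⟨fun σ N => Nat.rec (motive := fun _ => ℕ → ℝ) (fun _ => 0)
        (fun _ ih n => 1 / (σ * β n + ih (n + 1))) N, fun _ _ => rfl, fun _ _ _ => rfl⟩
  have H : (∀ n, 2 ≤ β n) ∧ (∀ σ n, T σ 0 n = 0) ∧
      ∀ σ N n, T σ (N + 1) n = 1 / (σ * β n + T σ N (n + 1)) := ⟨hβ, hT0, hTs⟩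
  obtain ⟨u, hu⟩ := cf_exists_limit H
  -- the characteristic equation u₀(σ) = c σ, c = l(l² + s)/(k² − l²)
  set c : ℝ := (l : ℝ) * ((l : ℝ) ^ 2 + s) / ((k : ℝ) ^ 2 - (l : ℝ) ^ 2) with hc
  have hc0 : 0 < c := by rw [hc]; exact div_pos (mul_pos hl0 (by positivity)) hgap0
  have hβ1 : β 1 = 2 * ((l : ℝ) ^ 2 + 4 * (k : ℝ) ^ 2) * ((l : ℝ) ^ 2 + 4 * (k : ℝ) ^ 2 + s) /
      ((l : ℝ) * ((l : ℝ) ^ 2 + 3 * (k : ℝ) ^ 2)) := by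
    rw [hβdef 1]; unfold cpA cpW; push_cast; ring
  have hβ0 : β 0 = 2 * ((l : ℝ) ^ 2 + (k : ℝ) ^ 2) * ((l : ℝ) ^ 2 + (k : ℝ) ^ 2 + s) /
      ((l : ℝ) * (l : ℝ) ^ 2) := by
    rw [hβdef 0]; unfold cpA cpW; push_cast; ring
  have hcb' : c < β 1 := by
    rw [hc, hβ1, div_lt_div_iff₀ hgap0 (by positivity)]
    nlinarith [hcb]
  obtain ⟨σ, hσ, hchar, hup, hlow⟩ := exists_root H hu hc0 hcb'
  obtain ⟨ξ, hξ0, hdec, hmode⟩ := mode_of_root hl hlk hs hβdef H hσ (hu σ hσ) (by rw [hchar])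
  -- the window for λ = 1/σ
  have e : c * β 0 = lamSqLower k l s := by
    rw [hc, hβ0]; unfold lamSqLower; field_simp
  have e' : c / β 1 = defect k l s := by
    rw [hc, hβ1]; unfold defect; field_simp
  refine ⟨1 / σ, one_div_pos.2 hσ, ?_, ?_, ξ, hξ0, hdec, hmode⟩
  · -- λ² ≥ Λ: from σ² c b₀ ≤ 1
    rw [← e, one_div_pow, le_div_iff₀ (pow_pos hσ 2)]
    calc c * β 0 * σ ^ 2 = σ ^ 2 * (c * β 0) := by ring
      _ ≤ 1 := hup
  · -- λ² (1 − θ) ≤ Λ: from 1 − c/b₁ ≤ σ² c b₀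
    rw [← e, ← e', one_div_pow, div_mul_eq_mul_div, one_mul, div_le_iff₀ (pow_pos hσ 2)]
    calc 1 - c / β 1 ≤ σ ^ 2 * (c * β 0) := hlow
      _ = c * β 0 * σ ^ 2 := by ring

/-- **Instability at every Reynolds number above the window (Meshalkin–Sinai 1961; Chen–Price 1997,
Lemma 2.2: `ρ_l(λ) < 0` beyond the bifurcation point).** For integers `1 ≤ l < k` and every
Reynolds number `λ > 0` with `λ²(1 − θ(k,l,0)) > Λ(k,l,0)` — i.e. above the window of
`exists_mode` at `s = 0` (this forces `θ(k,l,0) < 1`, the long-wave range) — the linearised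
Kolmogorov problem has a GROWING mode: some `s > 0` and an exponentially decaying real `ξ`,
`ξ₀ ≠ 0`, solving the chain (9) with `ρ = −s` (normal mode `e^{st}Σ ξ_m cos(lx + mky)`). Proof:
at fixed `σ = 1/λ` the characteristic function `H(s) = u₀^{(s)}(σ) − σl(l²+s)/(k²−l²)` is
continuous in `s` (the truncated continued fractions converge uniformly in `s`, their elements
being affine in `s` and `≥ 2`), positive at `s = 0` by the second truncation (this is the
hypothesis on `λ`), and negative at `s = lλ` by the first truncation (`Λ(k,l,s) ≥ 2s²/l²`);
intermediate value theorem. [cite: ChenPrice1997, Lemma 2.2 ((d/dλ)ρ_l < 0, ρ_l(λ_l) = 0); MeshalkinSinai1961] -/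
theorem exists_growingMode {k l : ℕ} (hl : 1 ≤ l) (hlk : l < k)
    {lam : ℝ} (hlam : 0 < lam) (hwin : lamSqLower k l 0 < lam ^ 2 * (1 - defect k l 0)) :
    ∃ s : ℝ, 0 < s ∧ ∃ ξ : ℤ → ℝ, ξ 0 ≠ 0 ∧
      (∃ K r : ℝ, 0 ≤ K ∧ 0 < r ∧ r < 1 ∧ ∀ m : ℤ, |ξ m| ≤ K * r ^ m.natAbs) ∧
      IsMode k l lam (-s) ξ := by
  -- real casts of the integer parameters
  have hl' : (1 : ℝ) ≤ l := by exact_mod_cast hl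
  have hl0 : (0 : ℝ) < l := by linarith
  have hkl : (l : ℝ) + 1 ≤ k := by exact_mod_cast hlk
  have hgap0 : (0 : ℝ) < (k : ℝ) ^ 2 - (l : ℝ) ^ 2 := by nlinarith
  have hgapne : (k : ℝ) ^ 2 - (l : ℝ) ^ 2 ≠ 0 := hgap0.ne'
  have h3k : (l : ℝ) ^ 2 + 3 * (k : ℝ) ^ 2 ≠ 0 := by positivity
  have h4k : (l : ℝ) ^ 2 + 4 * (k : ℝ) ^ 2 ≠ 0 := by positivity
  set σ : ℝ := 1 / lam with hσdef
  have hσ : 0 < σ := by rw [hσdef]; exact one_div_pos.2 hlam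
  -- the `s`-family of chains: elements, truncations, limits
  obtain ⟨βf, hβf⟩ : ∃ βf : ℝ → ℕ → ℝ, ∀ s n, βf s n =
      2 * cpW k l ((n : ℝ) + 1) * (cpW k l ((n : ℝ) + 1) + s) / cpA k l ((n : ℝ) + 1) :=
    ⟨_, fun s n => rfl⟩
  obtain ⟨Tf, hTf0, hTfs⟩ : ∃ Tf : ℝ → ℝ → ℕ → ℕ → ℝ, (∀ s σ' n, Tf s σ' 0 n = 0) ∧
      ∀ s σ' N n, Tf s σ' (N + 1) n = 1 / (σ' * βf s n + Tf s σ' N (n + 1)) :=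
    ⟨fun s σ' N => Nat.rec (motive := fun _ => ℕ → ℝ) (fun _ => 0)
        (fun _ ih n => 1 / (σ' * βf s n + ih (n + 1))) N, fun _ _ _ => rfl, fun _ _ _ _ => rfl⟩
  have Hf : ∀ s, 0 ≤ s → (∀ n, 2 ≤ βf s n) ∧ (∀ σ' n, Tf s σ' 0 n = 0) ∧
      ∀ σ' N n, Tf s σ' (N + 1) n = 1 / (σ' * βf s n + Tf s σ' N (n + 1)) := fun s hs =>
    ⟨fun n => by rw [hβf]; exact two_le_chainElt hl' hs n, hTf0 s, hTfs s⟩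
  obtain ⟨uf, huf⟩ : ∃ uf : ℝ → ℝ → ℕ → ℝ, ∀ s, 0 ≤ s → ∀ σ', 0 < σ' → ∀ n,
      Tendsto (fun N => Tf s σ' N n) atTop (𝓝 (uf s σ' n)) :=
    ⟨fun s σ' n => limUnder atTop fun N => Tf s σ' N n,
      fun s hs σ' hσ' n => (cf_cauchySeq (Hf s hs) hσ' n).tendsto_limUnder⟩
  -- continuity of s ↦ Tf s σ N n on [0, ∞)
  have hTcont : ∀ N n, ContinuousOn (fun s => Tf s σ N n) (Set.Ici 0) := by
    intro N
    induction N with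
    | zero => intro n; simp only [hTf0]; exact continuousOn_const
    | succ N ih =>
      intro n
      have h : (fun s => Tf s σ (N + 1) n) = fun s => 1 / (σ * βf s n + Tf s σ N (n + 1)) :=
        funext fun s => hTfs s σ N n
      rw [h]
      have hβcont : Continuous fun s => βf s n := by
        have e : (fun s => βf s n) = fun s =>
            2 * cpW k l ((n : ℝ) + 1) * (cpW k l ((n : ℝ) + 1) + s) / cpA k l ((n : ℝ) + 1) :=
          funext fun s => hβf s n
        rw [e]
        exact ((continuous_const.mul (continuous_const.add continuous_id)).div_const _)
      refine ContinuousOn.div continuousOn_const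
        ((continuousOn_const.mul hβcont.continuousOn).add (ih (n + 1))) fun s hs => ?_
      have h1 := (cf_bounds (Hf s hs) (σ := σ) hσ N (n + 1)).1
      have h2 : 0 < σ * βf s n := mul_pos hσ (by linarith [(Hf s hs).1 n])
      exact (add_pos_of_pos_of_nonneg h2 h1).ne'
  -- continuity of s ↦ uf s σ 0 on [0, ∞): uniform limit of the truncations
  have hucont : ContinuousOn (fun s => uf s σ 0) (Set.Ici 0) := by
    have hunif : TendstoUniformlyOn (fun N s => Tf s σ N 0) (fun s => uf s σ 0) atTop (Set.Ici 0) := by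
      rw [Metric.tendstoUniformlyOn_iff]
      intro δ hδ
      obtain ⟨hr0, hr1⟩ := cf_rate_lt_one hσ
      have htend : Tendsto (fun N => (1 + 4 * σ ^ 2) / (2 * σ) * (1 / (1 + 4 * σ ^ 2)) ^ N /
          (1 - 1 / (1 + 4 * σ ^ 2))) atTop
          (𝓝 ((1 + 4 * σ ^ 2) / (2 * σ) * 0 / (1 - 1 / (1 + 4 * σ ^ 2)))) :=
        ((tendsto_pow_atTop_nhds_zero_of_lt_one hr0 hr1).const_mul _).div_const _
      rw [mul_zero, zero_div] at htend
      filter_upwards [htend.eventually_lt_const hδ] with N hN s hs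
      rw [dist_comm]
      exact (cf_dist_limit (Hf s hs) hσ le_rfl (huf s hs σ hσ 0) N).trans_lt hN
    refine hunif.continuousOn (Filter.Eventually.frequently (Filter.Eventually.of_forall fun N => ?_))
    exact hTcont N 0
  -- the characteristic function G(s) = uf s σ 0 − c(s) σ and its signs at s = 0 and s = l·lam
  set cf : ℝ → ℝ := fun s => (l : ℝ) * ((l : ℝ) ^ 2 + s) / ((k : ℝ) ^ 2 - (l : ℝ) ^ 2) with hcfdef
  set S : ℝ := (l : ℝ) * lam with hSdef
  have hS0 : 0 < S := mul_pos hl0 hlam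
  have hGcont : ContinuousOn (fun s => uf s σ 0 - cf s * σ) (Set.Icc 0 S) := by
    refine (hucont.mono Set.Icc_subset_Ici_self).sub ?_
    have : Continuous fun s => cf s * σ := by
      rw [hcfdef]
      exact ((continuous_const.mul (continuous_const.add continuous_id)).div_const _).mul
        continuous_const
    exact this.continuousOn
  -- s = 0: positive, by the second truncation (this is the hypothesis on lam)
  have hG0 : 0 < uf 0 σ 0 - cf 0 * σ := by
    have H0 := Hf 0 le_rfl
    obtain ⟨-, -, hrel⟩ := cf_limit_props H0 hσ (huf 0 le_rfl σ hσ) 0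
    obtain ⟨hpos1, hle1, -⟩ := cf_limit_props H0 hσ (huf 0 le_rfl σ hσ) 1
    have hb0 : 0 < βf 0 0 := by linarith [H0.1 0]
    have hb1 : 0 < βf 0 1 := by linarith [H0.1 1]
    have hD : 0 < σ * βf 0 0 + 1 / (σ * βf 0 1) := by positivity
    have hlow : 1 / (σ * βf 0 0 + 1 / (σ * βf 0 1)) ≤ uf 0 σ 0 := by
      rw [hrel]
      exact one_div_le_one_div_of_le (by positivity) (by linarith)
    have hc0 : 0 < cf 0 := by
      rw [hcfdef]; exact div_pos (mul_pos hl0 (by positivity)) hgap0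
    -- the hypothesis in the form σ² c b₀ + c/b₁ < 1
    have e : cf 0 * βf 0 0 = lamSqLower k l 0 := by
      rw [hcfdef, hβf]; unfold lamSqLower cpA cpW; push_cast; field_simp; ring
    have e' : cf 0 / βf 0 1 = defect k l 0 := by
      rw [hcfdef, hβf]; unfold defect cpA cpW; push_cast; field_simp; ring
    have hkey' : σ ^ 2 * (cf 0 * βf 0 0) + cf 0 / βf 0 1 < 1 := by
      rw [e, e', hσdef, one_div_pow, one_div_mul_eq_div, div_add' _ _ _ (pow_pos hlam 2).ne',
        div_lt_one (pow_pos hlam 2)]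
      linarith
    have hkey : cf 0 * σ < 1 / (σ * βf 0 0 + 1 / (σ * βf 0 1)) := by
      rw [lt_div_iff₀ hD]
      have e1 : cf 0 * σ * (σ * βf 0 0 + 1 / (σ * βf 0 1)) = σ ^ 2 * (cf 0 * βf 0 0) + cf 0 / βf 0 1 := by
        field_simp
      rw [e1]
      exact hkey'
    linarith
  -- s = S = l·lam: negative, by the first truncation (Λ(k,l,S) ≥ 2S²/l² = 2 lam²)
  have hGS : uf S σ 0 - cf S * σ < 0 := by
    have HS := Hf S hS0.le
    obtain ⟨-, hle, -⟩ := cf_limit_props HS hσ (huf S hS0.le σ hσ) 0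
    have hb0 : 0 < βf S 0 := by linarith [HS.1 0]
    have hbig : 1 < σ ^ 2 * (cf S * βf S 0) := by
      have e : cf S * βf S 0 = lamSqLower k l S := by
        rw [hcfdef, hβf]; unfold lamSqLower cpA cpW; push_cast; field_simp; ring
      have hΛ : 2 * lam ^ 2 ≤ lamSqLower k l S := by
        unfold lamSqLower
        rw [le_div_iff₀ (by positivity), hSdef]
        have h1 : (l : ℝ) ^ 2 + (k : ℝ) ^ 2 + (l : ℝ) * lam ≥ (l : ℝ) * lam := by nlinarith
        have h2 : (l : ℝ) ^ 2 + (l : ℝ) * lam ≥ (l : ℝ) * lam := by nlinarith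
        have h3 : (k : ℝ) ^ 2 - (l : ℝ) ^ 2 ≤ (l : ℝ) ^ 2 + (k : ℝ) ^ 2 := by nlinarith
        have hp1 : 0 ≤ (l : ℝ) * lam := by positivity
        calc 2 * lam ^ 2 * ((l : ℝ) ^ 2 * ((k : ℝ) ^ 2 - (l : ℝ) ^ 2))
            = 2 * ((l : ℝ) * lam) * ((k : ℝ) ^ 2 - (l : ℝ) ^ 2) * ((l : ℝ) * lam) := by ring
          _ ≤ 2 * ((l : ℝ) ^ 2 + (l : ℝ) * lam) * ((l : ℝ) ^ 2 + (k : ℝ) ^ 2) *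
              ((l : ℝ) ^ 2 + (k : ℝ) ^ 2 + (l : ℝ) * lam) := by
            gcongr
      rw [e, hσdef, one_div_pow, one_div_mul_eq_div, lt_div_iff₀ (pow_pos hlam 2)]
      nlinarith [pow_pos hlam 2]
    have h1 : 1 / (σ * βf S 0) < cf S * σ := by
      rw [div_lt_iff₀ (mul_pos hσ hb0)]; nlinarith
    linarith
  -- intermediate value theorem on [0, S]: a root s ∈ (0, S]
  have hmem : (0 : ℝ) ∈ Set.Icc ((fun s => uf s σ 0 - cf s * σ) S) ((fun s => uf s σ 0 - cf s * σ) 0) :=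
    ⟨hGS.le, hG0.le⟩
  obtain ⟨s, ⟨hs0, hsS⟩, hs⟩ := intermediate_value_Icc' hS0.le hGcont hmem
  have hs_pos : 0 < s := by
    rcases eq_or_lt_of_le hs0 with h | h
    · exfalso; rw [← h] at hs; exact absurd hs hG0.ne'
    · exact h
  have hroot : uf s σ 0 = cf s * σ := sub_eq_zero.1 hs
  -- the mode at this s
  obtain ⟨ξ, hξ0, hdec, hmode⟩ := mode_of_root hl hlk hs0 (hβf s) (Hf s hs0) hσ (huf s hs0 σ hσ)
    (by rw [hroot, hcfdef])
  refine ⟨s, hs_pos, ξ, hξ0, hdec, ?_⟩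
  have : 1 / σ = lam := by rw [hσdef, one_div_one_div]
  rw [this] at hmode
  exact hmode

/-- The range condition of `exists_mode` holds for every growth rate `s ≥ 0` once `2l ≤ k`
(long waves `a = l/k ≤ 1/2`). [folklore] -/
private theorem range_of_two_mul_le {k l : ℕ} (hl : 1 ≤ l) (h2 : 2 * l ≤ k) {s : ℝ} (hs : 0 ≤ s) :
    (l : ℝ) ^ 2 * ((l : ℝ) ^ 2 + s) * ((l : ℝ) ^ 2 + 3 * (k : ℝ) ^ 2) <
      2 * ((k : ℝ) ^ 2 - (l : ℝ) ^ 2) * ((l : ℝ) ^ 2 + 4 * (k : ℝ) ^ 2) * ((l : ℝ) ^ 2 + 4 * (k : ℝ) ^ 2 + s) := by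
  have hl' : (1 : ℝ) ≤ l := by exact_mod_cast hl
  have h2' : 2 * (l : ℝ) ≤ k := by exact_mod_cast h2
  set K2 : ℝ := (k : ℝ) ^ 2 with hK2
  set L2 : ℝ := (l : ℝ) ^ 2 with hL2
  have hL1 : 1 ≤ L2 := by rw [hL2]; nlinarith
  have hKL : 4 * L2 ≤ K2 := by rw [hL2, hK2]; nlinarith
  have hL0 : 0 < L2 := by linarith
  have hK0 : 0 < K2 := by linarith
  -- LHS ≤ L2 · ((13/16) K² + (13/4) K s)
  have hfac : (L2 + s) * (L2 + 3 * K2) ≤ 13 / 16 * K2 ^ 2 + 13 / 4 * K2 * s := by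
    nlinarith [mul_nonneg (show (0 : ℝ) ≤ K2 / 4 - L2 by linarith)
      (show (0 : ℝ) ≤ L2 + K2 / 4 + 3 * K2 + s by linarith)]
  have hlhs : L2 * (L2 + s) * (L2 + 3 * K2) ≤ L2 * (13 / 16 * K2 ^ 2 + 13 / 4 * K2 * s) := by
    rw [mul_assoc]; exact mul_le_mul_of_nonneg_left hfac hL0.le
  -- RHS ≥ 2 · (3K/4) · 4K · (4K + s) = 6 K² (4K + s)
  have ha : 3 * K2 / 4 ≤ K2 - L2 := by linarith
  have hb : 4 * K2 ≤ L2 + 4 * K2 := by linarith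
  have hcs : 4 * K2 + s ≤ L2 + 4 * K2 + s := by linarith
  have hrhs : 2 * (3 * K2 / 4) * (4 * K2) * (4 * K2 + s) ≤
      2 * (K2 - L2) * (L2 + 4 * K2) * (L2 + 4 * K2 + s) := by
    have h1 : 2 * (3 * K2 / 4) * (4 * K2) ≤ 2 * (K2 - L2) * (L2 + 4 * K2) := by
      nlinarith [mul_le_mul ha hb (by linarith) (by linarith)]
    have hnn : (0 : ℝ) ≤ 2 * (K2 - L2) * (L2 + 4 * K2) := by
      have := mul_nonneg (show (0 : ℝ) ≤ K2 - L2 by linarith) (show (0 : ℝ) ≤ L2 + 4 * K2 by linarith)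
      linarith
    exact mul_le_mul h1 hcs (by linarith) hnn
  -- compare the two middle terms: L2 ≤ K2/4
  have hmid : L2 * (13 / 16 * K2 ^ 2 + 13 / 4 * K2 * s) < 2 * (3 * K2 / 4) * (4 * K2) * (4 * K2 + s) := by
    nlinarith [mul_pos hK0 hK0, mul_nonneg hK0.le hs, mul_nonneg (mul_nonneg hK0.le hK0.le) hs,
      mul_pos (mul_pos hK0 hK0) hK0]
  linarith

/-- **Growing long-wave modes for every growth rate (`2l ≤ k`).** For integers `1 ≤ l`, `2l ≤ k`
and every `s ≥ 0` there is a Reynolds number `λ` in the window of `exists_mode` carrying a normal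
mode `e^{st} Σ ξ_m cos(lx + mky)` of the linearised Kolmogorov problem.
[cite: ChenPrice1997, §2 (9)–(14), Lemma 2.2] -/
theorem exists_mode_of_two_mul_le {k l : ℕ} (hl : 1 ≤ l) (h2 : 2 * l ≤ k) {s : ℝ} (hs : 0 ≤ s) :
    ∃ lam : ℝ, 0 < lam ∧ lamSqLower k l s ≤ lam ^ 2 ∧ lam ^ 2 * (1 - defect k l s) ≤ lamSqLower k l s ∧
      ∃ ξ : ℤ → ℝ, ξ 0 ≠ 0 ∧
        (∃ K r : ℝ, 0 ≤ K ∧ 0 < r ∧ r < 1 ∧ ∀ m : ℤ, |ξ m| ≤ K * r ^ m.natAbs) ∧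
        IsMode k l lam (-s) ξ :=
  exists_mode hl (by omega) hs (range_of_two_mul_le hl h2 hs)

/-- Size of the window on the neutral curve for long waves: `θ(k,l,0) ≤ (l/k)⁴/4` when `2l ≤ k`, so
the two bounds of `exists_neutralMode` differ by a factor `≤ (1 − a⁴/4)⁻¹`, `a = l/k`, and both tend
to the Meshalkin–Sinai value `Re² = 2` as `a → 0`. [folklore] -/
private theorem defect_zero_le {k l : ℕ} (hl : 1 ≤ l) (h2 : 2 * l ≤ k) :
    defect k l 0 ≤ ((l : ℝ) / k) ^ 4 / 4 := by
  have hl' : (1 : ℝ) ≤ l := by exact_mod_cast hl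
  have h2' : 2 * (l : ℝ) ≤ k := by exact_mod_cast h2
  have hk0 : (0 : ℝ) < k := by linarith
  set K2 : ℝ := (k : ℝ) ^ 2 with hK2
  set L2 : ℝ := (l : ℝ) ^ 2 with hL2
  have hL1 : 1 ≤ L2 := by rw [hL2]; nlinarith
  have hKL : 4 * L2 ≤ K2 := by rw [hL2, hK2]; nlinarith
  have hL0 : 0 < L2 := by linarith
  have hK0 : 0 < K2 := by linarith
  have e : ((l : ℝ) / k) ^ 4 / 4 = L2 ^ 2 / (4 * K2 ^ 2) := by
    rw [hL2, hK2, div_pow]; field_simp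
  have e' : defect k l 0 = L2 ^ 2 * (L2 + 3 * K2) / (2 * (K2 - L2) * (L2 + 4 * K2) ^ 2) := by
    unfold defect; simp only [add_zero]; rw [← hL2, ← hK2]; ring
  rw [e, e', div_le_div_iff₀ (by nlinarith) (by positivity)]
  -- L²(L+3K)·4K² ≤ L²·2(K−L)(L+4K)²: divide by L² and use 4L ≤ K
  have hcore : (L2 + 3 * K2) * (4 * K2 ^ 2) ≤ 2 * (K2 - L2) * (L2 + 4 * K2) ^ 2 := by
    nlinarith [mul_nonneg (mul_nonneg hK0.le hK0.le) (show (0 : ℝ) ≤ K2 - 4 * L2 by linarith),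
      mul_nonneg (mul_nonneg hK0.le hL0.le) hL0.le, mul_nonneg (mul_nonneg hL0.le hL0.le) hL0.le,
      mul_nonneg (mul_nonneg hK0.le hK0.le) hL0.le]
  nlinarith [mul_le_mul_of_nonneg_left hcore (sq_nonneg L2)]

/-- **The neutral curve (Meshalkin–Sinai 1961; Chen–Price 1997, Lemma 2.2, the bifurcation points
`λ_l`).** For integers `1 ≤ l`, `2l ≤ k` there is a Reynolds number `λ` with
`2(l²+k²)²/(k²−l²) ≤ λ²` (Chen–Price's printed bound for `λ_l`) and
`λ²(1 − (l/k)⁴/4) ≤ 2(l²+k²)²/(k²−l²)` at which the Navier–Stokes equations linearised at the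
Kolmogorov flow `(sin ky, 0)` have a steady (neutral) mode `Σ ξ_m cos(lx + mky)`, `ξ₀ ≠ 0`,
exponentially decaying. With `Re = λ/k`, `a = l/k ≤ 1/2`:
`2(1+a²)²/(1−a²) ≤ Re² ≤ 2(1+a²)²/((1−a²)(1 − a⁴/4))`, so `Re → √2` as `a → 0` — the long-wave
threshold `ν_c = 1/√2` of the "negative eddy viscosity" `ν_E = ν − 1/(2ν)` (Frisch (9.60);
Shklyaev–Nepomnyashchy (5.103): `R = √2[1 + 3a²/2 + O(a⁴)]`).
[cite: ChenPrice1997, Lemma 2.2 (existence of λ_l and the bound 2(k²+l²)²/(k²−l²) < λ_l²); MeshalkinSinai1961] -/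
theorem exists_neutralMode {k l : ℕ} (hl : 1 ≤ l) (h2 : 2 * l ≤ k) :
    ∃ lam : ℝ, 0 < lam ∧
      2 * ((l : ℝ) ^ 2 + (k : ℝ) ^ 2) ^ 2 / ((k : ℝ) ^ 2 - (l : ℝ) ^ 2) ≤ lam ^ 2 ∧
      lam ^ 2 * (1 - ((l : ℝ) / k) ^ 4 / 4) ≤
        2 * ((l : ℝ) ^ 2 + (k : ℝ) ^ 2) ^ 2 / ((k : ℝ) ^ 2 - (l : ℝ) ^ 2) ∧
      ∃ ξ : ℤ → ℝ, ξ 0 ≠ 0 ∧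
        (∃ K r : ℝ, 0 ≤ K ∧ 0 < r ∧ r < 1 ∧ ∀ m : ℤ, |ξ m| ≤ K * r ^ m.natAbs) ∧
        IsMode k l lam 0 ξ := by
  obtain ⟨lam, hlam, hlo, hhi, ξ, hξ0, hdec, hmode⟩ := exists_mode_of_two_mul_le hl h2 le_rfl
  have hl' : (1 : ℝ) ≤ l := by exact_mod_cast hl
  have hl0 : (l : ℝ) ≠ 0 := by positivity
  have hkl : (l : ℝ) + 1 ≤ k := by exact_mod_cast (show l < k by omega)
  have hgap : (k : ℝ) ^ 2 - (l : ℝ) ^ 2 ≠ 0 := by nlinarith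
  have e1 : lamSqLower k l 0 = 2 * ((l : ℝ) ^ 2 + (k : ℝ) ^ 2) ^ 2 / ((k : ℝ) ^ 2 - (l : ℝ) ^ 2) := by
    unfold lamSqLower
    simp only [add_zero]
    rw [div_eq_div_iff (mul_ne_zero (pow_ne_zero 2 hl0) hgap) hgap]
    ring
  refine ⟨lam, hlam, e1 ▸ hlo, ?_, ξ, hξ0, hdec, by simpa using hmode⟩
  have hθ := defect_zero_le hl h2
  have hsq : 0 ≤ lam ^ 2 := sq_nonneg lam
  calc lam ^ 2 * (1 - ((l : ℝ) / k) ^ 4 / 4) ≤ lam ^ 2 * (1 - defect k l 0) :=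
        mul_le_mul_of_nonneg_left (by linarith) hsq
    _ ≤ lamSqLower k l 0 := hhi
    _ = _ := e1

/-- **Every Reynolds number above `2(l²+k²)²/((k²−l²)(1 − (l/k)⁴/4))` is linearly unstable
(`2l ≤ k`; Meshalkin–Sinai 1961, Chen–Price 1997 Lemma 2.2).** For integers `1 ≤ l`, `2l ≤ k` and
every `λ > 0` with `λ²(1 − (l/k)⁴/4) > 2(l²+k²)²/(k²−l²)`, the chain (9) of the Navier–Stokes
equations on `[0,2π]²` linearised at `(sin ky, 0)` (viscosity `1`, Reynolds number `λ`) has a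
solution with `ρ = −s`, `s > 0`: a growing normal mode `e^{st}Σ_m ξ_m cos(lx + mky)`, `ξ` real,
exponentially decaying, `ξ₀ ≠ 0`. With `Re = λ/k` and `a = l/k ≤ 1/2` the hypothesis reads
`Re² > 2(1+a²)²/((1−a²)(1−a⁴/4))` (Meshalkin–Sinai: `Re_c(a)² = 2(1+a²)²/(1−a²)·(1 + O(a⁴)) → 2`).
[cite: ChenPrice1997, Lemma 2.2; MeshalkinSinai1961] -/
theorem exists_growingMode_of_two_mul_le {k l : ℕ} (hl : 1 ≤ l) (h2 : 2 * l ≤ k)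
    {lam : ℝ} (hlam : 0 < lam)
    (hwin : 2 * ((l : ℝ) ^ 2 + (k : ℝ) ^ 2) ^ 2 / ((k : ℝ) ^ 2 - (l : ℝ) ^ 2) <
      lam ^ 2 * (1 - ((l : ℝ) / k) ^ 4 / 4)) :
    ∃ s : ℝ, 0 < s ∧ ∃ ξ : ℤ → ℝ, ξ 0 ≠ 0 ∧
      (∃ K r : ℝ, 0 ≤ K ∧ 0 < r ∧ r < 1 ∧ ∀ m : ℤ, |ξ m| ≤ K * r ^ m.natAbs) ∧
      IsMode k l lam (-s) ξ := by
  have hl' : (1 : ℝ) ≤ l := by exact_mod_cast hl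
  have hl0 : (l : ℝ) ≠ 0 := by positivity
  have hlk : l < k := by omega
  have hkl : (l : ℝ) + 1 ≤ k := by exact_mod_cast hlk
  have hgap : (k : ℝ) ^ 2 - (l : ℝ) ^ 2 ≠ 0 := by nlinarith
  have e1 : lamSqLower k l 0 = 2 * ((l : ℝ) ^ 2 + (k : ℝ) ^ 2) ^ 2 / ((k : ℝ) ^ 2 - (l : ℝ) ^ 2) := by
    unfold lamSqLower
    simp only [add_zero]
    rw [div_eq_div_iff (mul_ne_zero (pow_ne_zero 2 hl0) hgap) hgap]
    ring
  refine exists_growingMode hl hlk hlam ?_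
  have hθ := defect_zero_le hl h2
  have hsq : 0 ≤ lam ^ 2 := sq_nonneg lam
  calc lamSqLower k l 0 = _ := e1
    _ < lam ^ 2 * (1 - ((l : ℝ) / k) ^ 4 / 4) := hwin
    _ ≤ lam ^ 2 * (1 - defect k l 0) := mul_le_mul_of_nonneg_left (by linarith) hsq

/-! ## E. The eigenvalue of the linearised Navier–Stokes operator on the unit torus

The chain modes above are Fourier-side objects.  This section assembles them into genuine
eigenfunctions of the classical linearisation `Torus.linearizedNSOperator` of `LinearizedNSTorus`
on the flat unit torus `T³ = (ℝ/ℤ)³`, for a single-harmonic unidirectional shear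
`U = 2|z| cos(2πk x₁ + arg z) e₀` (`z = Û(ke₁)₀`, Fourier support `{±k e₁}`, values parallel to
`e₀` — the setting of `KolmogorovShear.not_isLinNSEigenvalue_shear` with wavenumber `k` instead of
`1`).  Units: Chen–Price's `∂ₜu − Δu + λu·∇u + ∇p` on `[0,2π]²` becomes `NS_ν` on `T³` under
`x = 2πx'`, `t = 4π²ν t'`, `u = v/A` with `λ = A/(2πν)` (`A = 2|z|` the amplitude of `U`), and a chain
mode of growth rate `s` (`ρ = −s`) becomes an eigenfunction with eigenvalue `μ = 4π²ν s`.  The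
eigenfunction is complex (`IsLinNSEigenvalue` is the point spectrum of the complexification) and
two-dimensional (`x₂`-independent, third component zero): `ŵ(l, mk, 0) = η_m (mk, −l, 0)`,
`η_m = (iz/|z|)^m ξ_m`, pressure `q̂(l, mk, 0) = 2l²k (z η_{m−1} − z̄ η_{m+1})/(l² + m²k²)`, all
other coefficients zero; coefficientwise (`SteadyLattice.mFourierCoeff_convect_complex`,
`mFourierCoeff_stretch`, `mFourierCoeff_gradientC`, `Torus.mFourierCoeff_laplacian`) the resolvent
equation is the pair of momentum equations whose curl is the chain (9) and whose divergence
defines `q̂`.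
-/

section Eigen

open scoped BigOperators ComplexConjugate
open Set Function MeasureTheory UnitAddTorus Complex
open Literature.Analysis.FunctionSpaces Literature.Analysis.FunctionSpaces.Torus
open Literature.Analysis.FunctionSpaces.EuclideanSpace
open Literature.Analysis.FluidPDE.ScalarFourier Literature.Analysis.FluidPDE.SteadyLattice
open Literature.Analysis.FluidPDE.KolmogorovShear

/-! ### E1. The line `κ_m = (l, mk, 0)` of the frequency lattice -/

/-- The frequencies `κ_m = (l, mk, 0) ∈ ℤ³` of the modes `e^{2πi(l x₀ + mk x₁)}`. [folklore] -/
private def lineVec (l k : ℕ) (m : ℤ) : Fin 3 → ℤ := ![(l : ℤ), m * k, 0]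

/-- Components of `κ_m`. [folklore] -/
@[simp] private theorem lineVec_zero (l k : ℕ) (m : ℤ) : lineVec l k m 0 = l := rfl
/-- Components of `κ_m`. [folklore] -/
@[simp] private theorem lineVec_one (l k : ℕ) (m : ℤ) : lineVec l k m 1 = m * k := rfl
/-- Components of `κ_m`. [folklore] -/
@[simp] private theorem lineVec_two (l k : ℕ) (m : ℤ) : lineVec l k m 2 = 0 := rfl

/-- The shear wave vector `k e₁ = (0, k, 0)`. [folklore] -/
private def shearVec (k : ℕ) : Fin 3 → ℤ := Pi.single 1 (k : ℤ)

/-- Components of `k e₁`. [folklore] -/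
@[simp] private theorem shearVec_zero (k : ℕ) : shearVec k 0 = 0 := by simp [shearVec]
/-- Components of `k e₁`. [folklore] -/
@[simp] private theorem shearVec_one (k : ℕ) : shearVec k 1 = k := by simp [shearVec]
/-- Components of `k e₁`. [folklore] -/
@[simp] private theorem shearVec_two (k : ℕ) : shearVec k 2 = 0 := by simp [shearVec]

/-- `m ↦ κ_m` is injective (`k ≥ 1`). [folklore] -/
private theorem lineVec_injective (l : ℕ) {k : ℕ} (hk : 1 ≤ k) : Injective (lineVec l k) := by
  intro m m' h
  have h1 := congrFun h 1
  simp only [lineVec_one] at h1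
  have hk0 : (k : ℤ) ≠ 0 := by exact_mod_cast (show k ≠ 0 by omega)
  exact mul_right_cancel₀ hk0 h1

/-- `κ_m − k e₁ = κ_{m−1}`. [folklore] -/
private theorem lineVec_sub_shearVec (l k : ℕ) (m : ℤ) : lineVec l k m - shearVec k = lineVec l k (m - 1) := by
  ext i; fin_cases i <;> simp [sub_mul]

/-- `κ_m + k e₁ = κ_{m+1}`. [folklore] -/
private theorem lineVec_add_shearVec (l k : ℕ) (m : ℤ) : lineVec l k m + shearVec k = lineVec l k (m + 1) := by
  ext i; fin_cases i <;> simp [add_mul]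

/-- The line is invariant under the shift by `−k e₁`. [folklore] -/
private theorem not_mem_range_sub {l k : ℕ} {κ : Fin 3 → ℤ} (h : κ ∉ Set.range (lineVec l k)) :
    κ - shearVec k ∉ Set.range (lineVec l k) := by
  rintro ⟨m, hm⟩
  apply h
  refine ⟨m + 1, ?_⟩
  rw [← lineVec_add_shearVec, hm, sub_add_cancel]

/-- The line is invariant under the shift by `+k e₁`. [folklore] -/
private theorem not_mem_range_add {l k : ℕ} {κ : Fin 3 → ℤ} (h : κ ∉ Set.range (lineVec l k)) :
    κ + shearVec k ∉ Set.range (lineVec l k) := by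
  rintro ⟨m, hm⟩
  apply h
  refine ⟨m - 1, ?_⟩
  rw [← lineVec_sub_shearVec, hm, add_sub_cancel_right]

/-- `|κ_m|² = l² + m²k²` (`= β_{l,m}`). [folklore] -/
private theorem freqNormSq_lineVec (l k : ℕ) (m : ℤ) :
    freqNormSq (lineVec l k m) = (l : ℝ) ^ 2 + (m : ℝ) ^ 2 * (k : ℝ) ^ 2 := by
  rw [freqNormSq, Fin.sum_univ_three]
  simp [lineVec]
  ring

/-- `κ_m ≠ 0` for `l ≥ 1`. [folklore] -/
private theorem lineVec_ne_zero {l : ℕ} (hl : 1 ≤ l) (k : ℕ) (m : ℤ) : lineVec l k m ≠ 0 := by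
  intro h
  have := congrFun h 0
  simp at this
  omega

/-- `0` is not on the line (`l ≥ 1`). [folklore] -/
private theorem zero_not_mem_range {l : ℕ} (hl : 1 ≤ l) (k : ℕ) : (0 : Fin 3 → ℤ) ∉ Set.range (lineVec l k) := by
  rintro ⟨m, hm⟩
  exact lineVec_ne_zero hl k m hm

/-- `k e₁ ≠ −k e₁` for `k ≥ 1`. [folklore] -/
private theorem shearVec_ne_neg {k : ℕ} (hk : 1 ≤ k) : shearVec k ≠ -shearVec k := by
  intro h
  have h1 := congrFun h 1
  simp at h1
  omega

/-! ### E2. Summability along the line and rapid decay of line-supported families -/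

/-- `∑_{m∈ℤ} (|m|+1)^p r^{|m|} < ∞` for `0 ≤ r < 1`. [folklore] -/
private theorem summable_pow_mul_geometric_int {r : ℝ} (hr0 : 0 ≤ r) (hr1 : r < 1) (p : ℕ) :
    Summable fun m : ℤ => ((m.natAbs : ℝ) + 1) ^ p * r ^ m.natAbs := by
  have hnat : Summable fun n : ℕ => ((n : ℝ) + 1) ^ p * r ^ n := by
    have h : ∀ j : ℕ, Summable fun n : ℕ => (n : ℝ) ^ j * r ^ n := fun j =>
      summable_pow_mul_geometric_of_norm_lt_one j (by rw [Real.norm_eq_abs, abs_of_nonneg hr0]; exact hr1)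
    have : (fun n : ℕ => ((n : ℝ) + 1) ^ p * r ^ n) =
        fun n : ℕ => ∑ j ∈ Finset.range (p + 1), ((p.choose j : ℝ) * ((n : ℝ) ^ j * r ^ n)) := by
      funext n
      rw [add_pow, Finset.sum_mul]
      refine Finset.sum_congr rfl fun j _ => ?_
      rw [one_pow, mul_one]; ring
    rw [this]
    exact summable_sum fun j _ => (h j).mul_left _
  refine summable_int_iff_summable_nat_and_neg.2 ⟨?_, ?_⟩
  · simpa only [Int.natAbs_natCast] using hnat
  · simpa only [Int.natAbs_neg, Int.natAbs_natCast] using hnat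

/-- Rapid decay of a family supported on the line `κ_m`, with geometric decay along it. [folklore] -/
private theorem rapidDecay_extend {V : Type*} [NormedAddCommGroup V] [NormedSpace ℂ V] {l k : ℕ} (hk : 1 ≤ k)
    {g : ℤ → V} {C r : ℝ} {p : ℕ} (hr0 : 0 ≤ r) (hr1 : r < 1)
    (hg : ∀ m, ‖g m‖ ≤ C * ((m.natAbs : ℝ) + 1) ^ p * r ^ m.natAbs) :
    RapidDecay (Function.extend (lineVec l k) g 0) := by
  intro s
  have hinj := lineVec_injective l hk
  rw [← hinj.summable_iff (f := fun κ => (1 + freqNormSq κ) ^ s * ‖Function.extend (lineVec l k) g 0 κ‖)]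
  · -- along the line
    have hB : ∀ m : ℤ, (1 + freqNormSq (lineVec l k m)) ≤
        (1 + (l : ℝ) ^ 2 + (k : ℝ) ^ 2) * ((m.natAbs : ℝ) + 1) ^ 2 := by
      intro m
      rw [freqNormSq_lineVec]
      have hm : ((m : ℝ)) ^ 2 = (m.natAbs : ℝ) ^ 2 := by
        rw [Nat.cast_natAbs, Int.cast_abs, sq_abs]
      rw [hm]
      have h0 : (0 : ℝ) ≤ m.natAbs := Nat.cast_nonneg _
      nlinarith [sq_nonneg (l : ℝ), sq_nonneg (k : ℝ), mul_nonneg (sq_nonneg (k : ℝ)) h0,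
        mul_nonneg (sq_nonneg (l : ℝ)) h0, sq_nonneg ((m.natAbs : ℝ))]
    refine Summable.of_nonneg_of_le (fun m => mul_nonneg (one_add_freqNormSq_pow_nonneg _ _) (norm_nonneg _))
      (fun m => ?_) (((summable_pow_mul_geometric_int hr0 hr1 (2 * s + p)).mul_left
        ((1 + (l : ℝ) ^ 2 + (k : ℝ) ^ 2) ^ s * C)))
    simp only [Function.comp_apply, hinj.extend_apply]
    calc (1 + freqNormSq (lineVec l k m)) ^ s * ‖g m‖
        ≤ ((1 + (l : ℝ) ^ 2 + (k : ℝ) ^ 2) * ((m.natAbs : ℝ) + 1) ^ 2) ^ s *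
            (C * ((m.natAbs : ℝ) + 1) ^ p * r ^ m.natAbs) := by
          gcongr
          · linarith [freqNormSq_nonneg (lineVec l k m)]
          · exact hB m
          · exact hg m
      _ = (1 + (l : ℝ) ^ 2 + (k : ℝ) ^ 2) ^ s * C * (((m.natAbs : ℝ) + 1) ^ (2 * s + p) * r ^ m.natAbs) := by
          rw [mul_pow, ← pow_mul, pow_add]; ring
  · intro κ hκ
    rw [Function.extend_apply' _ _ _ (by rintro ⟨m, hm⟩; exact hκ ⟨m, hm⟩), Pi.zero_apply, norm_zero,
      mul_zero]

/-! ### E3. The symbols of the shear `U = z e^{2πi k x₁} e₀ + z̄ e^{−2πi k x₁} e₀` -/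

/-- The stretching symbol `N(ĉ, â)₀` of a unidirectional shear with wave vector `k e₁`:
`N(c, a)(κ)₀ = 2πi k (a(ke₁)₀ c(κ−ke₁)₁ − a(−ke₁)₀ c(κ+ke₁)₁)`. [folklore] -/
private theorem transportSym_stretch_shearVec {a c : (Fin 3 → ℤ) → EuclideanSpace ℂ (Fin 3)} {k : ℕ} (hk : 1 ≤ k)
    (hsupp : ∀ m, m ≠ shearVec k → m ≠ -shearVec k → a m = 0) (κ : Fin 3 → ℤ) :
    transportSym (fun j m => c m j) (fun m => a m 0) κ =
      2 * Real.pi * I * (k : ℂ) *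
        (a (shearVec k) 0 * c (κ - shearVec k) 1 - a (-shearVec k) 0 * c (κ + shearVec k) 1) := by
  rw [transportSym_apply]
  have h : ∀ j, lconv (fun m => c m j) (fun m => dsym j m * a m 0) κ =
      c (κ - shearVec k) j * (dsym j (shearVec k) * a (shearVec k) 0) +
        c (κ + shearVec k) j * (dsym j (-shearVec k) * a (-shearVec k) 0) :=
    fun j => lconv_of_support_pair_right (shearVec_ne_neg hk) (fun m h1 h2 => by rw [hsupp m h1 h2]; simp) κ
  rw [Fin.sum_univ_three, h 0, h 1, h 2]
  simp only [dsym_apply, Pi.neg_apply, shearVec_zero, shearVec_one, shearVec_two]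
  push_cast; ring

/-! ### E4. From the Fourier side back to the operator -/

/-- **The linearised resolvent equation from its Fourier coefficients**: if for smooth `w`, `q` the
identities `−ν4π²|κ|² ŵ(κ)_p − (N(Û,ŵ)(κ)_p + N(ŵ,Û)(κ)_p) − 2πi q̂(κ) κ_p − μ ŵ(κ)_p = 0` hold for all
`κ ∈ ℤ³`, `p`, then `L(ν,U)(w,q) − μ w = 0` pointwise (continuity and vanishing of all Fourier
coefficients, Grafakos 2014, Prop. 3.2.4; the coefficient dictionary is
`SteadyLattice.mFourierCoeff_convect_complex`, `mFourierCoeff_stretch`, `mFourierCoeff_gradientC`,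
`Torus.mFourierCoeff_laplacian`). [cite: Grafakos2014, Prop. 3.2.4] -/
theorem linearizedNSOperator_sub_smul_eq_zero {ν : ℝ} {U : UnitAddTorus (Fin 3) → EuclideanSpace ℝ (Fin 3)}
    (hU : IsSmooth U) {w : UnitAddTorus (Fin 3) → EuclideanSpace ℂ (Fin 3)} {q : UnitAddTorus (Fin 3) → ℂ}
    (hw : IsSmooth w) (hq : IsSmooth q) (μ : ℂ)
    (h : ∀ (κ : Fin 3 → ℤ) (p : Fin 3),
      -((ν * (4 * Real.pi ^ 2 * freqNormSq κ) : ℝ) : ℂ) * mFourierCoeff w κ p -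
        (transportSym (fun j m => mFourierCoeff (complexify ∘ U) m j) (fun m => mFourierCoeff w m p) κ +
          transportSym (fun j m => mFourierCoeff w m j) (fun m => mFourierCoeff (complexify ∘ U) m p) κ) -
        2 * Real.pi * I * mFourierCoeff q κ * (κ p : ℂ) - μ * mFourierCoeff w κ p = 0) :
    ∀ x, Torus.linearizedNSOperator ν U w q x - μ • w x = 0 := by
  have i1 : Integrable (fun y => laplacian w y) volume := hw.laplacian.integrable
  have i1' : Integrable ((ν : ℂ) • fun y => laplacian w y) volume := i1.smul (ν : ℂ)
  have i2 : Integrable (Torus.convect U w) volume := (hU.convect hw).integrable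
  have i3 : Integrable (Torus.stretch w U) volume := (isSmooth_stretch hU hw).integrable
  have hgc : Continuous (Torus.gradientC q) :=
    (PiLp.continuous_toLp 2 _).comp (continuous_pi fun l => (hq.partialDeriv l).continuous)
  have i4 : Integrable (Torus.gradientC q) volume := hgc.integrable_unitAddTorus
  have i5 : Integrable (μ • w) volume := hw.integrable.smul μ
  have hfun : (fun y => Torus.linearizedNSOperator ν U w q y - μ • w y) =
      ((ν : ℂ) • fun y => laplacian w y) - (Torus.convect U w + Torus.stretch w U) - Torus.gradientC q -
        μ • w := by
    funext y
    simp only [Torus.linearizedNSOperator_apply, Pi.sub_apply, Pi.add_apply, Pi.smul_apply, Complex.coe_smul]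
  have hcont : Continuous (fun y => Torus.linearizedNSOperator ν U w q y - μ • w y) := by
    rw [hfun]
    exact ((((hw.laplacian.continuous.const_smul (ν : ℂ)).sub
      ((hU.convect hw).continuous.add (isSmooth_stretch hU hw).continuous)).sub hgc).sub
      (hw.continuous.const_smul μ))
  have hzero : (fun y => Torus.linearizedNSOperator ν U w q y - μ • w y) = 0 := by
    refine eq_zero_of_forall_mFourierCoeff_eq_zero hcont fun κ => ?_
    rw [hfun, mFourierCoeff_sub ((i1'.sub (i2.add i3)).sub i4) i5,
      mFourierCoeff_sub (i1'.sub (i2.add i3)) i4, mFourierCoeff_sub i1' (i2.add i3), mFourierCoeff_add i2 i3,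
      mFourierCoeff_const_smul, mFourierCoeff_const_smul, mFourierCoeff_convect_complex hU hw κ,
      mFourierCoeff_stretch hU hw κ, mFourierCoeff_gradientC hq κ,
      show (fun y => laplacian w y) = laplacian w from rfl, Torus.mFourierCoeff_laplacian hw κ]
    ext p
    simp only [PiLp.sub_apply, PiLp.add_apply, PiLp.smul_apply, PiLp.neg_apply, smul_eq_mul,
      Torus.freqVec_apply, PiLp.zero_apply]
    have := h κ p
    push_cast at this ⊢
    linear_combination this
  intro x
  exact congrFun hzero x

/-- **Divergence-freeness from transversality of the Fourier coefficients**: a smooth complex field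
with `κ · ŵ(κ) = 0` for all `κ` is divergence free (uniqueness of the Fourier coefficients of the
continuous function `div w`, Grafakos 2014, Prop. 3.2.4). [cite: Grafakos2014, Prop. 3.2.4] -/
theorem isDivFreeC_of_fourier {w : UnitAddTorus (Fin 3) → EuclideanSpace ℂ (Fin 3)} (hw : IsSmooth w)
    (h : ∀ κ : Fin 3 → ℤ, ∑ p, ((κ p : ℤ) : ℂ) * mFourierCoeff w κ p = 0) : Torus.IsDivFreeC w := by
  set Dv : UnitAddTorus (Fin 3) → ℂ := fun x => ∑ l, Torus.partialDeriv l (fun y => w y l) x with hDv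
  have hwl : ∀ l, IsSmooth (fun x => w x l) := fun l =>
    hw.comp_clm ((EuclideanSpace.proj l : EuclideanSpace ℂ (Fin 3) →L[ℂ] ℂ).restrictScalars ℝ)
  have hcont : Continuous Dv := continuous_finsetSum _ fun l _ => ((hwl l).partialDeriv l).continuous
  have hcoeff : ∀ κ, mFourierCoeff Dv κ = 2 * Real.pi * I * ∑ p, ((κ p : ℤ) : ℂ) * mFourierCoeff w κ p := by
    intro κ
    rw [hDv, mFourierCoeff_finset_sum (f := fun l => Torus.partialDeriv l (fun x => w x l)) _
      (fun l _ => ((hwl l).partialDeriv l).integrable), Finset.mul_sum]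
    refine Finset.sum_congr rfl fun l _ => ?_
    rw [mFourierCoeff_partialDeriv (hwl l) l κ, coeff_apply_complex hw κ l, smul_eq_mul]
    ring
  have hD0 : Dv = 0 :=
    eq_zero_of_forall_mFourierCoeff_eq_zero hcont fun κ => by rw [hcoeff, h κ, mul_zero]
  intro x
  have := congrFun hD0 x
  simpa [hDv, Torus.divergenceC] using this

/-! ### E5. The eigenfunction carried by a chain mode -/

/-- The polarisation vector `(mk, −l, 0)` of the divergence-free mode with frequency `κ_m = (l, mk, 0)`
(stream function `e^{2πi κ_m·x}`: velocity `∝ (κ₁, −κ₀, 0)`). [folklore] -/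
private def polVec (l k : ℕ) (m : ℤ) : Fin 3 → ℂ := ![(m : ℂ) * (k : ℂ), -(l : ℂ), 0]

/-- Components of the polarisation vector. [folklore] -/
@[simp] private theorem polVec_zero (l k : ℕ) (m : ℤ) : polVec l k m 0 = (m : ℂ) * (k : ℂ) := rfl
/-- Components of the polarisation vector. [folklore] -/
@[simp] private theorem polVec_one (l k : ℕ) (m : ℤ) : polVec l k m 1 = -(l : ℂ) := rfl
/-- Components of the polarisation vector. [folklore] -/
@[simp] private theorem polVec_two (l k : ℕ) (m : ℤ) : polVec l k m 2 = 0 := rfl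

/-- `‖(mk, −l, 0)‖ ≤ |m|k + l`. [folklore] -/
private theorem norm_toLp_polVec_le (l k : ℕ) (m : ℤ) :
    ‖(WithLp.toLp 2 (polVec l k m) : EuclideanSpace ℂ (Fin 3))‖ ≤ (m.natAbs : ℝ) * k + l := by
  rw [EuclideanSpace.norm_eq, Fin.sum_univ_three]
  simp only [polVec_zero, polVec_one, polVec_two, norm_mul, norm_neg, norm_zero,
    Complex.norm_natCast, Complex.norm_intCast]
  have hm : |(m : ℝ)| = (m.natAbs : ℝ) := by rw [Nat.cast_natAbs, Int.cast_abs]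
  rw [hm]
  have h0 : (0 : ℝ) ≤ (m.natAbs : ℝ) * k + l := by positivity
  calc Real.sqrt (((m.natAbs : ℝ) * k) ^ 2 + (l : ℝ) ^ 2 + 0 ^ 2)
      ≤ Real.sqrt (((m.natAbs : ℝ) * k + l) ^ 2) := by
        apply Real.sqrt_le_sqrt
        nlinarith [mul_nonneg (mul_nonneg (Nat.cast_nonneg (α := ℝ) m.natAbs) (Nat.cast_nonneg (α := ℝ) k))
          (Nat.cast_nonneg (α := ℝ) l)]
    _ = (m.natAbs : ℝ) * k + l := Real.sqrt_sq h0

/-- **A chain mode is an eigenfunction of the linearised Navier–Stokes operator at the Kolmogorov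
flow.** Let `U : T³ → ℝ³` be smooth with Fourier support `{±k e₁}` and values parallel to `e₀`
(`U = 2|z| cos(2πk x₁ + arg z) e₀`, `z = Û(ke₁)₀ ≠ 0`), `ν > 0`, `1 ≤ l < k`. If the real sequence `ξ`
(`ξ₀ ≠ 0`, geometric decay) solves the Meshalkin–Sinai chain `IsMode k l λ (−s) ξ` at the Reynolds
number `λ = |z|/(πν)` (`= A/(2πν)`, `A = 2|z|` the amplitude of `U`), then `μ = 4π²νs` is an
eigenvalue of `L(ν,U)`: the field with Fourier coefficients `ŵ(l, mk, 0) = (iz/|z|)^m ξ_m (mk, −l, 0)`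
(zero elsewhere) and the pressure `q̂(l, mk, 0) = 2l²k(z η_{m−1} − z̄ η_{m+1})/(l² + m²k²)` satisfy
`νΔw − (U·∇)w − (w·∇)U − ∇q = μ w`, `div w = 0`, `∫w = 0`, `w ≠ 0` (coefficientwise this is the
chain, `SteadyLattice.mFourierCoeff_convect_complex` / `mFourierCoeff_stretch` / `mFourierCoeff_gradientC`
and Fourier synthesis `Torus.fourierSynth`). [cite: ChenPrice1997, §1 (1)–(5), §2 (7)–(10); MeshalkinSinai1961] -/
theorem isLinNSEigenvalue_of_isMode {ν : ℝ} (hν : 0 < ν) {k l : ℕ} (hl : 1 ≤ l) (hlk : l < k)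
    {U : UnitAddTorus (Fin 3) → EuclideanSpace ℝ (Fin 3)} (hU : IsSmooth U)
    (hsupp : ∀ m, m ≠ Pi.single 1 (k : ℤ) → m ≠ -Pi.single 1 (k : ℤ) →
      mFourierCoeff (complexify ∘ U) m = 0)
    (hdir : ∀ m (j : Fin 3), j ≠ 0 → mFourierCoeff (complexify ∘ U) m j = 0)
    (hz : mFourierCoeff (complexify ∘ U) (Pi.single 1 (k : ℤ)) 0 ≠ 0)
    {s : ℝ} {ξ : ℤ → ℝ} (hξ0 : ξ 0 ≠ 0)
    (hdec : ∃ K r : ℝ, 0 ≤ K ∧ 0 < r ∧ r < 1 ∧ ∀ m : ℤ, |ξ m| ≤ K * r ^ m.natAbs)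
    (hmode : IsMode k l (‖mFourierCoeff (complexify ∘ U) (Pi.single 1 (k : ℤ)) 0‖ / (Real.pi * ν)) (-s) ξ) :
    Torus.IsLinNSEigenvalue ν U (((4 * Real.pi ^ 2 * ν * s : ℝ)) : ℂ) := by
  -- names for the data of `U`; `shearVec k` is `Pi.single 1 k` by definition
  have hcs : IsConjSymm (fun κ => mFourierCoeff (complexify ∘ U) κ) := isConjSymm_mFourierCoeff hU.integrable
  obtain ⟨a, ha⟩ : ∃ a, mFourierCoeff (complexify ∘ U) = a := ⟨_, rfl⟩
  rw [ha] at hsupp hdir hz hmode hcs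
  change ∀ m, m ≠ shearVec k → m ≠ -shearVec k → a m = 0 at hsupp
  change a (shearVec k) 0 ≠ 0 at hz
  change IsMode k l (‖a (shearVec k) 0‖ / (Real.pi * ν)) (-s) ξ at hmode
  obtain ⟨z, hz'⟩ : ∃ z : ℂ, a (shearVec k) 0 = z := ⟨_, rfl⟩
  rw [hz'] at hz hmode
  have haz : a (-shearVec k) 0 = conj z := by
    have h := hcs (shearVec k)
    dsimp only at h
    rw [h, conjVec_apply, hz']
  obtain ⟨lam, hlam⟩ : ∃ lam : ℝ, ‖z‖ / (Real.pi * ν) = lam := ⟨_, rfl⟩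
  rw [hlam] at hmode
  obtain ⟨K, r, hK, hr0, hr1, hξ⟩ := hdec
  have hk : 1 ≤ k := by omega
  have hl' : (1 : ℝ) ≤ l := by exact_mod_cast hl
  have hπ0 : Real.pi ≠ 0 := Real.pi_ne_zero
  have hzn0 : ‖z‖ ≠ 0 := norm_ne_zero_iff.2 hz
  have hnzC : ((‖z‖ : ℝ) : ℂ) ≠ 0 := by exact_mod_cast hzn0
  -- the phase θ = iz/|z| and the complex amplitudes η_m = θ^m ξ_m
  obtain ⟨θ, hθ⟩ : ∃ θ : ℂ, I * z / ((‖z‖ : ℝ) : ℂ) = θ := ⟨_, rfl⟩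
  have hθ0 : θ ≠ 0 := by rw [← hθ]; exact div_ne_zero (mul_ne_zero I_ne_zero hz) hnzC
  have hθn : ‖θ‖ = 1 := by
    rw [← hθ, norm_div, norm_mul, Complex.norm_I, one_mul, Complex.norm_real, Real.norm_eq_abs, abs_norm,
      div_self hzn0]
  have hθ1 : I * z * θ⁻¹ = ((‖z‖ : ℝ) : ℂ) := by
    rw [← hθ]; field_simp
  have hθ2 : I * conj z * θ = -((‖z‖ : ℝ) : ℂ) := by
    have hzz : conj z * z = ((‖z‖ : ℝ) : ℂ) ^ 2 := Complex.conj_mul' z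
    rw [← hθ, show I * conj z * (I * z / ((‖z‖ : ℝ) : ℂ)) = (I * I) * (conj z * z) / ((‖z‖ : ℝ) : ℂ) by ring,
      hzz, I_mul_I]
    field_simp
  obtain ⟨η, hη⟩ : ∃ η : ℤ → ℂ, (fun m => θ ^ m * (ξ m : ℂ)) = η := ⟨_, rfl⟩
  have hηm : ∀ m, η m = θ ^ m * (ξ m : ℂ) := fun m => by rw [← hη]
  have hηn : ∀ m, ‖η m‖ = |ξ m| := fun m => by
    rw [hηm, norm_mul, norm_zpow, hθn, one_zpow, one_mul, Complex.norm_real, Real.norm_eq_abs]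
  have hη0 : η 0 = (ξ 0 : ℂ) := by rw [hηm, zpow_zero, one_mul]
  have hηsub : ∀ m, η (m - 1) = θ ^ m * θ⁻¹ * (ξ (m - 1) : ℂ) := fun m => by rw [hηm, zpow_sub_one₀ hθ0]
  have hηadd : ∀ m, η (m + 1) = θ ^ m * θ * (ξ (m + 1) : ℂ) := fun m => by rw [hηm, zpow_add_one₀ hθ0]
  -- the chain, complexified: (V) 4π²ν(W+s)W η_m + 2πi (z α_{m-1} η_{m-1} + z̄ α_{m+1} η_{m+1}) = 0
  have hW0 : ∀ m : ℤ, (0 : ℝ) < cpW k l m := fun m => by unfold cpW; positivity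
  have hV : ∀ m : ℤ, 4 * Real.pi ^ 2 * (ν : ℂ) * (((cpW k l m : ℝ) : ℂ) + s) * ((cpW k l m : ℝ) : ℂ) * η m +
      2 * Real.pi * I * (z * ((cpA k l ((m : ℝ) - 1) : ℝ) : ℂ) * η (m - 1) +
        conj z * ((cpA k l ((m : ℝ) + 1) : ℝ) : ℂ) * η (m + 1)) = 0 := by
    intro m
    have h := hmode m
    rw [div_sub_div_same, div_add' _ _ _ (mul_ne_zero two_ne_zero (hW0 m).ne'), div_eq_zero_iff] at h
    have hchain : lam * (cpA k l ((m : ℝ) - 1) * ξ (m - 1) - cpA k l ((m : ℝ) + 1) * ξ (m + 1)) +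
        2 * cpW k l m * (cpW k l m + s) * ξ m = 0 := by
      rcases h with h | h
      · linear_combination h
      · exact absurd h (mul_ne_zero two_ne_zero (hW0 m).ne')
    have hchainC : (lam : ℂ) * (((cpA k l ((m : ℝ) - 1) : ℝ) : ℂ) * (ξ (m - 1) : ℂ) -
        ((cpA k l ((m : ℝ) + 1) : ℝ) : ℂ) * (ξ (m + 1) : ℂ)) +
        2 * ((cpW k l m : ℝ) : ℂ) * (((cpW k l m : ℝ) : ℂ) + s) * (ξ m : ℂ) = 0 := by
      have := congrArg (fun x : ℝ => (x : ℂ)) hchain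
      push_cast at this
      linear_combination this
    have hνC : (ν : ℂ) ≠ 0 := by exact_mod_cast hν.ne'
    have hπC : (Real.pi : ℂ) ≠ 0 := by exact_mod_cast hπ0
    have hzn : ((‖z‖ : ℝ) : ℂ) = (lam : ℂ) * Real.pi * ν := by
      rw [← hlam]; push_cast; field_simp
    rw [hηm m, hηsub, hηadd]
    linear_combination (2 * Real.pi * θ ^ m * (((cpA k l ((m : ℝ) - 1) : ℝ) : ℂ)) * (ξ (m - 1) : ℂ)) * hθ1 +
      (2 * Real.pi * θ ^ m * (((cpA k l ((m : ℝ) + 1) : ℝ) : ℂ)) * (ξ (m + 1) : ℂ)) * hθ2 +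
      (2 * Real.pi * θ ^ m * ((((cpA k l ((m : ℝ) - 1) : ℝ) : ℂ)) * (ξ (m - 1) : ℂ) -
        (((cpA k l ((m : ℝ) + 1) : ℝ) : ℂ)) * (ξ (m + 1) : ℂ))) * hzn +
      (θ ^ m * 2 * Real.pi ^ 2 * (ν : ℂ)) * hchainC
  -- the coefficient families of the eigenfield and of the pressure
  obtain ⟨g, hg⟩ : ∃ g : ℤ → EuclideanSpace ℂ (Fin 3),
      (fun m => η m • (WithLp.toLp 2 (polVec l k m) : EuclideanSpace ℂ (Fin 3))) = g := ⟨_, rfl⟩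
  have hgp : ∀ m p, g m p = η m * polVec l k m p := fun m p => by
    rw [← hg]; simp only [PiLp.smul_apply, smul_eq_mul]
  obtain ⟨Qf, hQf⟩ : ∃ Qf : ℤ → ℂ, (fun m => 2 * (l : ℂ) ^ 2 * (k : ℂ) * (z * η (m - 1) - conj z * η (m + 1)) /
      ((cpW k l m : ℝ) : ℂ)) = Qf := ⟨_, rfl⟩
  have hQW : ∀ m, Qf m * ((cpW k l m : ℝ) : ℂ) = 2 * (l : ℂ) ^ 2 * (k : ℂ) * (z * η (m - 1) - conj z * η (m + 1)) :=
    fun m => by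
      rw [← hQf]; simp only
      exact div_mul_cancel₀ _ (by exact_mod_cast (hW0 m).ne')
  set c : (Fin 3 → ℤ) → EuclideanSpace ℂ (Fin 3) := Function.extend (lineVec l k) g 0 with hc
  set Q : (Fin 3 → ℤ) → ℂ := Function.extend (lineVec l k) Qf 0 with hQ
  have hinj := lineVec_injective l hk
  have hc_on : ∀ m, c (lineVec l k m) = g m := fun m => by rw [hc, hinj.extend_apply]
  have hc_off : ∀ κ, κ ∉ Set.range (lineVec l k) → c κ = 0 := fun κ hκ => by
    rw [hc, Function.extend_apply' _ _ _ (by rintro ⟨m, hm⟩; exact hκ ⟨m, hm⟩), Pi.zero_apply]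
  have hQ_on : ∀ m, Q (lineVec l k m) = Qf m := fun m => by rw [hQ, hinj.extend_apply]
  have hQ_off : ∀ κ, κ ∉ Set.range (lineVec l k) → Q κ = 0 := fun κ hκ => by
    rw [hQ, Function.extend_apply' _ _ _ (by rintro ⟨m, hm⟩; exact hκ ⟨m, hm⟩), Pi.zero_apply]
  -- rapid decay of both families
  have hr0' : 0 ≤ r := hr0.le
  have hpow : ∀ m : ℤ, r ^ (m - 1).natAbs ≤ r ^ m.natAbs / r ∧ r ^ (m + 1).natAbs ≤ r ^ m.natAbs / r := by
    intro m
    constructor <;>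
    · rw [le_div_iff₀ hr0, ← pow_succ]
      exact pow_le_pow_of_le_one hr0' hr1.le (by omega)
  have hcr : RapidDecay c := by
    refine rapidDecay_extend (V := EuclideanSpace ℂ (Fin 3)) hk (C := ((k : ℝ) + l) * K) (p := 1) hr0' hr1
      fun m => ?_
    rw [← hg]
    simp only
    rw [norm_smul, hηn]
    have h1 := norm_toLp_polVec_le l k m
    have h2 := hξ m
    have h3 : (m.natAbs : ℝ) * k + l ≤ ((k : ℝ) + l) * (((m.natAbs : ℝ) + 1) ^ 1) := by
      rw [pow_one]; nlinarith [Nat.cast_nonneg (α := ℝ) m.natAbs, Nat.cast_nonneg (α := ℝ) l,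
        Nat.cast_nonneg (α := ℝ) k]
    calc |ξ m| * ‖(WithLp.toLp 2 (polVec l k m) : EuclideanSpace ℂ (Fin 3))‖
        ≤ (K * r ^ m.natAbs) * (((k : ℝ) + l) * (((m.natAbs : ℝ) + 1) ^ 1)) :=
          mul_le_mul h2 (h1.trans h3) (norm_nonneg _) ((abs_nonneg _).trans h2)
      _ = ((k : ℝ) + l) * K * ((m.natAbs : ℝ) + 1) ^ 1 * r ^ m.natAbs := by ring
  have hQr : RapidDecay Q := by
    refine rapidDecay_extend (V := ℂ) hk (C := 4 * (l : ℝ) ^ 2 * k * ‖z‖ * K / r) (p := 0) hr0' hr1 fun m => ?_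
    have hWm : (1 : ℝ) ≤ cpW k l m := by unfold cpW; nlinarith [sq_nonneg ((m : ℝ) * k)]
    have e : ‖Qf m‖ = ‖2 * (l : ℂ) ^ 2 * (k : ℂ) * (z * η (m - 1) - conj z * η (m + 1))‖ / cpW k l m := by
      rw [← hQf]; simp only
      rw [norm_div, Complex.norm_real, Real.norm_eq_abs, abs_of_pos (hW0 m)]
    rw [e, div_le_iff₀ (hW0 m), pow_zero, mul_one]
    have hnum : ‖2 * (l : ℂ) ^ 2 * (k : ℂ) * (z * η (m - 1) - conj z * η (m + 1))‖ ≤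
        2 * (l : ℝ) ^ 2 * k * (‖z‖ * |ξ (m - 1)| + ‖z‖ * |ξ (m + 1)|) := by
      rw [norm_mul, norm_mul, norm_mul, Complex.norm_two, norm_pow, Complex.norm_natCast, Complex.norm_natCast]
      gcongr
      refine (norm_sub_le _ _).trans ?_
      rw [norm_mul, norm_mul, hηn, hηn, Complex.norm_conj]
    have hb1 : |ξ (m - 1)| ≤ K * (r ^ m.natAbs / r) := (hξ (m - 1)).trans (by gcongr; exact (hpow m).1)
    have hb2 : |ξ (m + 1)| ≤ K * (r ^ m.natAbs / r) := (hξ (m + 1)).trans (by gcongr; exact (hpow m).2)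
    calc ‖2 * (l : ℂ) ^ 2 * (k : ℂ) * (z * η (m - 1) - conj z * η (m + 1))‖
        ≤ 2 * (l : ℝ) ^ 2 * k * (‖z‖ * |ξ (m - 1)| + ‖z‖ * |ξ (m + 1)|) := hnum
      _ ≤ 2 * (l : ℝ) ^ 2 * k * (‖z‖ * (K * (r ^ m.natAbs / r)) + ‖z‖ * (K * (r ^ m.natAbs / r))) := by
          gcongr
      _ = 4 * (l : ℝ) ^ 2 * k * ‖z‖ * K / r * r ^ m.natAbs * 1 := by
          field_simp; ring
      _ ≤ 4 * (l : ℝ) ^ 2 * k * ‖z‖ * K / r * r ^ m.natAbs * cpW k l m := by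
          gcongr
  -- the eigenfield and the pressure
  set w : UnitAddTorus (Fin 3) → EuclideanSpace ℂ (Fin 3) := fourierSynth c with hwdef
  set q : UnitAddTorus (Fin 3) → ℂ := fourierSynth Q with hqdef
  have hw : IsSmooth w := hcr.isSmooth_fourierSynth
  have hq : IsSmooth q := hQr.isSmooth_fourierSynth
  have hwc : mFourierCoeff w = c := funext fun κ => hcr.mFourierCoeff_fourierSynth κ
  have hqc : mFourierCoeff q = Q := funext fun κ => hQr.mFourierCoeff_fourierSynth κ
  refine ⟨w, ?_, hw, ?_, ?_, q, hq, fun x => ?_⟩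
  · -- w ≠ 0: its coefficient at κ₀ = (l, 0, 0) has second component -l ξ₀ ≠ 0
    intro hw0
    have h1 : mFourierCoeff w (lineVec l k 0) = 0 := by
      rw [hw0, mFourierCoeff_eq_integral_volume]; simp
    rw [hwc, hc_on] at h1
    have h2 := congrArg (fun v : EuclideanSpace ℂ (Fin 3) => v 1) h1
    simp only [hgp, polVec_one, PiLp.zero_apply, hη0, mul_neg, neg_eq_zero, mul_eq_zero,
      Complex.ofReal_eq_zero, Nat.cast_eq_zero] at h2
    rcases h2 with h2 | h2
    · exact hξ0 h2
    · omega
  · -- div w = 0: κ_m · (mk, -l, 0) = 0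
    refine isDivFreeC_of_fourier hw fun κ => ?_
    rw [hwc, Fin.sum_univ_three]
    by_cases hκ : κ ∈ Set.range (lineVec l k)
    · obtain ⟨m, rfl⟩ := hκ
      rw [hc_on, hgp, hgp, hgp]
      simp only [lineVec_zero, lineVec_one, lineVec_two, polVec_zero, polVec_one, polVec_two]
      push_cast; ring
    · rw [hc_off κ hκ]; simp
  · -- ∫ w = 0
    exact hasZeroMean_of_mFourierCoeff_zero (by rw [hwc, hc_off 0 (zero_not_mem_range hl k)])
  · -- the equation L(ν,U)(w,q) = μ w, coefficientwise
    rw [Pi.zero_apply]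
    refine linearizedNSOperator_sub_smul_eq_zero hU hw hq _ (fun κ p => ?_) x
    rw [ha, hwc, hqc, transportSym_shear_left (shearVec_ne_neg hk) (shearVec_zero k) hsupp hdir κ p, hz', haz]
    have hT2 : transportSym (fun j m => c m j) (fun m => a m p) κ =
        if p = 0 then 2 * Real.pi * I * (k : ℂ) * (z * c (κ - shearVec k) 1 - conj z * c (κ + shearVec k) 1)
        else 0 := by
      split_ifs with hp
      · rw [hp, transportSym_stretch_shearVec hk hsupp κ, hz', haz]
      · exact transportSym_shear_right_of_ne hdir κ hp
    rw [hT2]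
    by_cases hκ : κ ∈ Set.range (lineVec l k)
    · obtain ⟨m, rfl⟩ := hκ
      rw [lineVec_sub_shearVec, lineVec_add_shearVec, hc_on, hc_on, hc_on, hQ_on, freqNormSq_lineVec]
      have hWc : ((cpW k l m : ℝ) : ℂ) = (l : ℂ) ^ 2 + (m : ℂ) ^ 2 * (k : ℂ) ^ 2 := by
        unfold cpW; push_cast; ring
      have hAm : ((cpA k l ((m : ℝ) - 1) : ℝ) : ℂ) = (l : ℂ) * ((l : ℂ) ^ 2 + ((m : ℂ) - 1) ^ 2 * (k : ℂ) ^ 2 - (k : ℂ) ^ 2) := by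
        unfold cpA cpW; push_cast; ring
      have hAp : ((cpA k l ((m : ℝ) + 1) : ℝ) : ℂ) = (l : ℂ) * ((l : ℂ) ^ 2 + ((m : ℂ) + 1) ^ 2 * (k : ℂ) ^ 2 - (k : ℂ) ^ 2) := by
        unfold cpA cpW; push_cast; ring
      have hVm := hV m
      have hQWm := hQW m
      rw [hWc, hAm, hAp] at hVm
      rw [hWc] at hQWm
      have hWne : (l : ℂ) ^ 2 + (m : ℂ) ^ 2 * (k : ℂ) ^ 2 ≠ 0 := by
        rw [← hWc]; exact_mod_cast (hW0 m).ne'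
      have hp3 : p = 0 ∨ p = 1 ∨ p = 2 := by fin_cases p <;> simp
      rcases hp3 with rfl | rfl | rfl
      · -- p = 0
        rw [if_pos rfl]
        simp only [hgp, lineVec_zero, polVec_zero, polVec_one, dsym_apply]
        push_cast
        refine (mul_eq_zero.1 (?_ : _ * ((l : ℂ) ^ 2 + (m : ℂ) ^ 2 * (k : ℂ) ^ 2) = 0)).resolve_right hWne
        linear_combination (-((m : ℂ) * (k : ℂ))) * hVm + (-(2 * Real.pi * I * (l : ℂ))) * hQWm
      · -- p = 1
        rw [if_neg (by decide)]
        simp only [hgp, lineVec_zero, lineVec_one, polVec_one, dsym_apply]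
        push_cast
        refine (mul_eq_zero.1 (?_ : _ * ((l : ℂ) ^ 2 + (m : ℂ) ^ 2 * (k : ℂ) ^ 2) = 0)).resolve_right hWne
        linear_combination (l : ℂ) * hVm + (-(2 * Real.pi * I * (m : ℂ) * (k : ℂ))) * hQWm
      · -- p = 2
        rw [if_neg (by decide)]
        simp only [hgp, lineVec_two, polVec_two, dsym_apply]
        push_cast
        ring
    · have h1 := hc_off κ hκ
      have h2 := hc_off _ (not_mem_range_sub hκ)
      have h3 := hc_off _ (not_mem_range_add hκ)
      have h4 := hQ_off κ hκ
      rw [h1, h2, h3, h4]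
      simp

/-! ### E6. The positive eigenvalue of the linearised operator above the Meshalkin–Sinai window -/

/-- `Λ(k,l,0) > 0` for `1 ≤ l < k`. [folklore] -/
private theorem lamSqLower_zero_pos {k l : ℕ} (hl : 1 ≤ l) (hlk : l < k) : 0 < lamSqLower k l 0 := by
  have hl' : (1 : ℝ) ≤ l := by exact_mod_cast hl
  have hkl : (l : ℝ) + 1 ≤ k := by exact_mod_cast hlk
  have hgap : (0 : ℝ) < (k : ℝ) ^ 2 - (l : ℝ) ^ 2 := by nlinarith
  unfold lamSqLower
  positivity

/-- **The Kolmogorov flow is linearly unstable above the Meshalkin–Sinai window (Meshalkin–Sinai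
1961; Chen–Price 1997, Lemma 2.2), in the tree's vocabulary `Torus.IsLinNSEigenvalue`.** Let
`U : T³ → ℝ³` (`T³ = (ℝ/ℤ)³`) be smooth with Fourier support `{±k e₁}` and values parallel to `e₀` —
`U(x) = A sin(2πk x₁ + φ) e₀`, `A = 2|Û(ke₁)₀|` — and `ν > 0`. In Chen–Price's units (period `2π`,
viscosity `1`) the Reynolds number of `U` is `λ = A/(2πν) = |Û(ke₁)₀|/(πν)`. If for some integer
`1 ≤ l < k` (perturbation wavenumber `l` across the basic period, `a = l/k`) `λ` lies above the
window, `λ²(1 − θ(k,l,0)) > Λ(k,l,0)` (`lamSqLower`, `defect`), then the linearised Navier–Stokes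
operator `L(ν,U) w = νΔw − (U·∇)w − (w·∇)U − ∇q` (`div w = 0`, `∫w = 0`) has a POSITIVE REAL
eigenvalue `μ = 4π²νs`, `s > 0` the growth rate of `exists_growingMode`, with the eigenfunction of
`isLinNSEigenvalue_of_isMode`. (Contrast: for the gravest shear `k = 1` no `l < k` exists, and
`KolmogorovShear.not_isLinNSEigenvalue_shear` shows `0` is never an eigenvalue.)
[cite: ChenPrice1997, Lemma 2.2; MeshalkinSinai1961] -/
theorem exists_pos_isLinNSEigenvalue {ν : ℝ} (hν : 0 < ν) {k l : ℕ} (hl : 1 ≤ l) (hlk : l < k)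
    {U : UnitAddTorus (Fin 3) → EuclideanSpace ℝ (Fin 3)} (hU : IsSmooth U)
    (hsupp : ∀ m, m ≠ Pi.single 1 (k : ℤ) → m ≠ -Pi.single 1 (k : ℤ) →
      mFourierCoeff (complexify ∘ U) m = 0)
    (hdir : ∀ m (j : Fin 3), j ≠ 0 → mFourierCoeff (complexify ∘ U) m j = 0)
    (hwin : lamSqLower k l 0 <
      (‖mFourierCoeff (complexify ∘ U) (Pi.single 1 (k : ℤ)) 0‖ / (Real.pi * ν)) ^ 2 * (1 - defect k l 0)) :
    ∃ μ : ℂ, μ.im = 0 ∧ 0 < μ.re ∧ Torus.IsLinNSEigenvalue ν U μ := by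
  have hΛ := lamSqLower_zero_pos hl hlk
  have hz : mFourierCoeff (complexify ∘ U) (Pi.single 1 (k : ℤ)) 0 ≠ 0 := by
    intro h
    rw [h, norm_zero, zero_div, zero_pow two_ne_zero, zero_mul] at hwin
    exact absurd hwin (not_lt.2 hΛ.le)
  have hlam : 0 < ‖mFourierCoeff (complexify ∘ U) (Pi.single 1 (k : ℤ)) 0‖ / (Real.pi * ν) :=
    div_pos (norm_pos_iff.2 hz) (mul_pos Real.pi_pos hν)
  obtain ⟨s, hs, ξ, hξ0, hdec, hmode⟩ := exists_growingMode hl hlk hlam hwin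
  refine ⟨((4 * Real.pi ^ 2 * ν * s : ℝ) : ℂ), Complex.ofReal_im _, ?_,
    isLinNSEigenvalue_of_isMode hν hl hlk hU hsupp hdir hz hξ0 hdec hmode⟩
  rw [Complex.ofReal_re]
  positivity

/-- **Explicit threshold for long waves (`2l ≤ k`):** with `U`, `ν`, `λ = |Û(ke₁)₀|/(πν) = A/(2πν)` as
in `exists_pos_isLinNSEigenvalue`, if `λ²(1 − (l/k)⁴/4) > 2(l²+k²)²/(k²−l²)` for some `1 ≤ l ≤ k/2`
then `L(ν,U)` has a positive real eigenvalue. With the Reynolds number `Re = A/(2πkν) = λ/k` of the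
Kolmogorov flow `A sin(2πk x₁)e₀` (velocity `A`, length `1/(2πk)`, viscosity `ν`) and `a = l/k ≤ 1/2`
the hypothesis reads `Re² > 2(1+a²)²/((1−a²)(1−a⁴/4))`; Meshalkin–Sinai's neutral curve is
`Re_c(a)² = 2(1+a²)²/(1−a²)·(1+O(a⁴))`, `Re_c → √2` (Frisch 1995 (9.60): `ν_c = U₀/(√2 k)`).
[cite: ChenPrice1997, Lemma 2.2; MeshalkinSinai1961] -/
theorem exists_pos_isLinNSEigenvalue_of_two_mul_le {ν : ℝ} (hν : 0 < ν) {k l : ℕ} (hl : 1 ≤ l)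
    (h2 : 2 * l ≤ k) {U : UnitAddTorus (Fin 3) → EuclideanSpace ℝ (Fin 3)} (hU : IsSmooth U)
    (hsupp : ∀ m, m ≠ Pi.single 1 (k : ℤ) → m ≠ -Pi.single 1 (k : ℤ) →
      mFourierCoeff (complexify ∘ U) m = 0)
    (hdir : ∀ m (j : Fin 3), j ≠ 0 → mFourierCoeff (complexify ∘ U) m j = 0)
    (hwin : 2 * ((l : ℝ) ^ 2 + (k : ℝ) ^ 2) ^ 2 / ((k : ℝ) ^ 2 - (l : ℝ) ^ 2) <
      (‖mFourierCoeff (complexify ∘ U) (Pi.single 1 (k : ℤ)) 0‖ / (Real.pi * ν)) ^ 2 *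
        (1 - ((l : ℝ) / k) ^ 4 / 4)) :
    ∃ μ : ℂ, μ.im = 0 ∧ 0 < μ.re ∧ Torus.IsLinNSEigenvalue ν U μ := by
  have hl' : (1 : ℝ) ≤ l := by exact_mod_cast hl
  have hl0 : (l : ℝ) ≠ 0 := by positivity
  have hlk : l < k := by omega
  have hkl : (l : ℝ) + 1 ≤ k := by exact_mod_cast hlk
  have hgap : (k : ℝ) ^ 2 - (l : ℝ) ^ 2 ≠ 0 := by nlinarith
  have e1 : lamSqLower k l 0 = 2 * ((l : ℝ) ^ 2 + (k : ℝ) ^ 2) ^ 2 / ((k : ℝ) ^ 2 - (l : ℝ) ^ 2) := by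
    unfold lamSqLower
    simp only [add_zero]
    rw [div_eq_div_iff (mul_ne_zero (pow_ne_zero 2 hl0) hgap) hgap]
    ring
  refine exists_pos_isLinNSEigenvalue hν hl hlk hU hsupp hdir ?_
  have hθ := defect_zero_le hl h2
  have hsq : 0 ≤ (‖mFourierCoeff (complexify ∘ U) (Pi.single 1 (k : ℤ)) 0‖ / (Real.pi * ν)) ^ 2 :=
    sq_nonneg _
  calc lamSqLower k l 0 = _ := e1
    _ < _ := hwin
    _ ≤ _ := mul_le_mul_of_nonneg_left (by linarith) hsq

end Eigen

end KolmogorovViscous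

end Literature.Analysis.FluidPDE

end
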